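import Literature.NumberTheory.Automorphic.UnitaryIsotropicAbelianization
import HarnessLib

/-!
# The special unitary group of an isotropic hermitian form is perfect (Dieudonné) — EVERY finite rank

Topic `NumberTheory/Automorphic`; namespace `Literature.NumberTheory.Automorphic.UnitaryIsotropic`.  KERNEL only
(theorems, no definition, no notation, no instance, no named fact, no `sorry`).  Third part of the story
✔ `Automorphic/UnitaryIsotropicCharactersDet` (N408: every homomorphism `U(J) →* A`, `A` commutative, kills `SU(J)`) and
✔ `Automorphic/UnitaryIsotropicAbelianization` (N419: `U(J)′ = SU(J)`, `U(J)^{ab} ≅ N¹(σ)` via `det`): here the group `SU(J)` ITSELF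
has no non-trivial commutative quotient.

**Main theorem** (`su_apply_eq_one`, §8).  `K` a field with `2 ≠ 0`, `σ : K →+* K` an involution with `σ θ₀ = −θ₀ ≠ 0`
whose fixed field is not `𝔽₃` — i.e. some `α = σ α` has `α ≠ 0`, `α² ≠ 1` (`exists_fixed_sq_ne_one_of_three_ne_zero`: `α = 2`
whenever `3 ≠ 0`; automatic for number fields and all their completions) —, `J ∈ M_n(K)` (`n` ANY finite type) `σ`-hermitian,
non-degenerate and admitting an isotropic vector.  Then EVERY homomorphism from
`SU(J) = ker (det : unitaryGroupOfForm σ J →* Kˣ)` to a commutative group is trivial; equivalently (`su_commutator_eq_top`,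
`su_commutator_su_eq`, `commutator_commutator_eq`, `derivedSeries_two_eq_one`) `SU(J)` is PERFECT, `⁅SU(J), SU(J)⁆ = SU(J)`,
`U(J)″ = U(J)′`.  This is the commutative-field case of Dieudonné's theorem that for hermitian forms of Witt index `≥ 1` the
group `T_n(K, f)` generated by the unitary transvections is its own commutator group and equals `SU_n(K, f)`
[Dieudonne1971GroupesClassiques, Chap. II §5] (exceptions only over `𝔽₄`, excluded by `2 ≠ 0`, and `𝔽₉ ⊇ 𝔽₃`, excluded by the
fixed-field hypothesis).  In the tree it closes the «characters of `SU(V)(F_v)`» entry of the [Liu2021, Lem. D.1] audit: at a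
non-split place a hermitian space of rank `≥ 3` is isotropic (✔ `QuadraticForms/HermitianLocalIsotropy`), so `SU(V)(F_v)` has no
non-trivial character at all.

**Route** (abstract form `psi_eq_one_of_det_eq_one`, §7: a finite-dimensional `V`, a non-degenerate hermitian
`B : V →ₛₗ[σ] V →ₗ[K] K` with an isotropic vector, and a function `ψ : End V → A` multiplicative ONLY on isometries of
determinant `1`; strong induction on `dim V` along a hyperbolic pair `e, f`, `B e f = θ₀`).  The engine N408 conjugated by the
dilations `D(β)` (`e ↦ βe`, `f ↦ (σβ)⁻¹f`) of determinant `β/σβ ≠ 1`; here only determinant-one conjugators are allowed, and three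
changes make the argument go through inside `SU`:
* §2–§3 root elements `T(u, w, z)` based at `u ∈ {e, f}` are killed by conjugating with the DETERMINANT-ONE dilations `D(α)`
  (`σα = α`, `α² ≠ 1`: `D(α) T(e, 0, ζ) D(α)⁻¹ = T(e, 0, α²ζ)`) and `D(−1)`; `ψ (D(γ)) = 1` for `σγ = γ` by the `SL₂(K^σ)` identity
  `D(γ)·U(1)L(1)U(1) = U(γ)L(γ⁻¹)U(γ)`;
* §4 the Levi reduction of the engine with determinant bookkeeping: `g ↦ g₂ = t′ t g = D(p)·ι(h)`, `h ∈ U({e,f}^⊥)`,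
  `(p/σp)·det h = 1`, `ψ g₂ = ψ g`;
* §5 the NEW RANK-3 TORUS LEMMA `psi_dil_mul_quasi`: for `a ⊥ e, f` anisotropic and ANY `p ≠ 0`, the determinant-one element
  `D(p)·Q(a, σp/p)` (`Q` the quasi-symmetry along `a`) is killed — for `σp ≠ p` it is the product `P(0, x₂)·P(1, x₁)` of two
  «monomial» elements `P(γ, x) = T(e, b₁a, ζ) T(f, γa, x) T(e, b₂a, ζ)` (`P e = −xθ₀ f`, `P f = −(σx θ₀)⁻¹ e`, `P a = −(σx/x) a`;
  `x₂ = B a a/(p − σp)`, `x₁ = −p x₂`), six root elements based at `e` and `f` (`dil_mul_quasi_eq`, by the values on the frame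
  `e, a, f` and on its orthogonal complement);
* §6 complements and extension by the identity (the engine's §8), an explicit Hilbert 90 (`μ = σν/ν` for `σμ·μ = 1`);
* §7 the induction: `{e,f}^⊥` isotropic ⇒ `D(p) ι(h) = [D(p) Q(a, σp/p)]·ι(Q(a, p/σp) h)` with the second factor in
  `SU({e,f}^⊥)` (induction hypothesis); anisotropic ⇒ the engine's anisotropic Cartan–Dieudonné (✔ `aniso_cartan_dieudonne`) one
  quasi-symmetry at a time: `D(q) Q(b, σν/ν) k = [D(ν) Q(b, σν/ν)]·[D(q/ν) k]`;
* §8 the matrix dress via `Matrix.toLinearMapₛₗ₂'` ∕ `Matrix.toLin'` (`unitaryGroupOfForm` of ✔ `UnitaryGroupAutomorphicRep`,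
  cited not restated), `SU(J)` as the kernel subgroup `(GeneralLinearGroup.det.comp (unitaryGroupOfForm σ J).subtype).ker`
  (`su_mem_iff`), and the commutator forms via `Abelianization` and ✔ `commutator_eq_ker_det`.

Written for the pub-hodgecm2 (COR-CM) audit of [Liu2021, App. D Lemma D.1 (3)] (seat prover-pub-hodgecm2-b10); nothing here is
specific to number fields.  HC_CM is NOT proved.

## References

* J. Dieudonné, *La géométrie des groupes classiques*, 3e éd., Springer (1971), Chap. II §§4–5
  [Dieudonne1971GroupesClassiques].
-/

set_option autoImplicit false

universe u

namespace Literature.NumberTheory.Automorphic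

namespace UnitaryIsotropic

variable {K : Type*} [Field K] {σ : K →+* K} {V : Type*} [AddCommGroup V] [Module K V]

/-! ## §1 Sesquilinear bookkeeping and the elementary isometries (copies of the engine's private lemmas) -/

/-- `B (c • x) y = σ c * B x y`. [folklore] -/
private theorem apply_smul_left (B : V →ₛₗ[σ] V →ₗ[K] K) (c : K) (x y : V) : B (c • x) y = σ c * B x y := by
  rw [LinearMap.map_smulₛₗ, LinearMap.smul_apply, smul_eq_mul]

/-- `B x (c • y) = c * B x y`. [folklore] -/
private theorem apply_smul_right (B : V →ₛₗ[σ] V →ₗ[K] K) (c : K) (x y : V) : B x (c • y) = c * B x y := by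
  rw [map_smul, smul_eq_mul]

/-- `B (x + x') y = B x y + B x' y`. [folklore] -/
private theorem apply_add_left (B : V →ₛₗ[σ] V →ₗ[K] K) (x x' y : V) : B (x + x') y = B x y + B x' y := by
  rw [map_add, LinearMap.add_apply]

/-- `B (x - x') y = B x y - B x' y`. [folklore] -/
private theorem apply_sub_left (B : V →ₛₗ[σ] V →ₗ[K] K) (x x' y : V) : B (x - x') y = B x y - B x' y := by
  rw [map_sub, LinearMap.sub_apply]

/-- For a hermitian form, `B x y = 0 → B y x = 0`. [folklore] -/
private theorem apply_eq_zero_comm (B : V →ₛₗ[σ] V →ₗ[K] K) (hB : ∀ x y, σ (B x y) = B y x) {x y : V}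
    (h : B x y = 0) : B y x = 0 := by
  rw [← hB x y, h, map_zero]

/-- `Q(a, μ) y = y + ((μ - 1) (B a a)⁻¹ B a y) • a`. [folklore] -/
private theorem quasi_apply (B : V →ₛₗ[σ] V →ₗ[K] K) (a : V) (μ : K) (y : V) :
    ((1 : Module.End K V) + ((μ - 1) * (B a a)⁻¹) • (B a).smulRight a) y =
      y + ((μ - 1) * (B a a)⁻¹ * B a y) • a := by
  simp only [LinearMap.add_apply, Module.End.one_apply, LinearMap.smul_apply, LinearMap.smulRight_apply,
    smul_smul]

/-- `Q(a, μ) a = μ • a` (`B a a ≠ 0`). [folklore] -/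
private theorem quasi_apply_self (B : V →ₛₗ[σ] V →ₗ[K] K) (a : V) (ha : B a a ≠ 0) (μ : K) :
    ((1 : Module.End K V) + ((μ - 1) * (B a a)⁻¹) • (B a).smulRight a) a = μ • a := by
  rw [quasi_apply, inv_mul_cancel_right₀ ha]
  nth_rw 1 [← one_smul K a]
  rw [← add_smul, add_sub_cancel]

/-- `Q(a, μ) y = y` for `y ⊥ a`. [folklore] -/
private theorem quasi_apply_of_orth (B : V →ₛₗ[σ] V →ₗ[K] K) (a : V) (μ : K) {y : V} (hy : B a y = 0) :
    ((1 : Module.End K V) + ((μ - 1) * (B a a)⁻¹) • (B a).smulRight a) y = y := by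
  rw [quasi_apply, hy, mul_zero, zero_smul, add_zero]

/-- `Q(a, 1) = 1`. [folklore] -/
private theorem quasi_one (B : V →ₛₗ[σ] V →ₗ[K] K) (a : V) :
    ((1 : Module.End K V) + (((1 : K) - 1) * (B a a)⁻¹) • (B a).smulRight a) = 1 := by
  rw [sub_self, zero_mul, zero_smul, add_zero]

/-- `T(u, w, z) y = y + (B u y) • w + (z B u y − B w y) • u`. [folklore] -/
private theorem root_apply (B : V →ₛₗ[σ] V →ₗ[K] K) (u w : V) (z : K) (y : V) :
    ((1 : Module.End K V) + (B u).smulRight w + (z • B u - B w).smulRight u) y =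
      y + B u y • w + (z * B u y - B w y) • u := by
  simp only [LinearMap.add_apply, Module.End.one_apply, LinearMap.smulRight_apply, LinearMap.sub_apply,
    LinearMap.smul_apply, smul_eq_mul]

/-- `T(u, w, z) u = u`. [folklore] -/
private theorem root_apply_self (B : V →ₛₗ[σ] V →ₗ[K] K) (hB : ∀ x y, σ (B x y) = B y x) (u w : V) (z : K)
    (hu : B u u = 0) (huw : B u w = 0) :
    ((1 : Module.End K V) + (B u).smulRight w + (z • B u - B w).smulRight u) u = u := by
  rw [root_apply, hu, apply_eq_zero_comm B hB huw, mul_zero, sub_zero, zero_smul, zero_smul, add_zero, add_zero]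

/-- `T(u, w, z) y = y` for `y ⊥ u, w`. [folklore] -/
private theorem root_apply_of_orth (B : V →ₛₗ[σ] V →ₗ[K] K) (u w : V) (z : K) {y : V} (huy : B u y = 0)
    (hwy : B w y = 0) :
    ((1 : Module.End K V) + (B u).smulRight w + (z • B u - B w).smulRight u) y = y := by
  rw [root_apply, huy, hwy, mul_zero, sub_zero, zero_smul, zero_smul, add_zero, add_zero]

/-- `T(u, 0, z) y = y + (z B u y) • u` (a transvection). [folklore] -/
private theorem transv_apply (B : V →ₛₗ[σ] V →ₗ[K] K) (u : V) (z : K) (y : V) :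
    ((1 : Module.End K V) + (B u).smulRight (0 : V) + (z • B u - B (0 : V)).smulRight u) y =
      y + (z * B u y) • u := by
  rw [root_apply, map_zero, LinearMap.zero_apply, sub_zero, smul_zero, add_zero]

/-- `T(u, 0, 0) = 1`. [folklore] -/
private theorem root_zero (B : V →ₛₗ[σ] V →ₗ[K] K) (u : V) :
    ((1 : Module.End K V) + (B u).smulRight (0 : V) + ((0 : K) • B u - B (0 : V)).smulRight u) = 1 := by
  ext y
  rw [transv_apply, zero_mul, zero_smul, add_zero, Module.End.one_apply]

/-- **Inverse**: `T(u, w, z) T(u, −w, σ z) = 1` for an admissible `(w, z)`. [folklore] -/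
private theorem root_mul_root_neg (B : V →ₛₗ[σ] V →ₗ[K] K) (hB : ∀ x y, σ (B x y) = B y x) (u w : V) (z : K)
    (hu : B u u = 0) (huw : B u w = 0) (hz : z + σ z + B w w = 0) :
    ((1 : Module.End K V) + (B u).smulRight w + (z • B u - B w).smulRight u) *
        ((1 : Module.End K V) + (B u).smulRight (-w) + (σ z • B u - B (-w)).smulRight u) = 1 := by
  rw [root_mul_root B hB u w (-w) z (σ z) hu huw (by rw [map_neg, huw, neg_zero])]
  have h0 : z + σ z - B w (-w) = 0 := by rw [map_neg, sub_neg_eq_add]; exact hz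
  ext y
  rw [root_apply, Module.End.one_apply, add_neg_cancel, h0, map_zero, LinearMap.zero_apply, zero_mul, sub_zero,
    smul_zero, zero_smul, add_zero, add_zero]

/-- `B f e = −θ₀`. [folklore] -/
private theorem apply_fe (B : V →ₛₗ[σ] V →ₗ[K] K) (hB : ∀ x y, σ (B x y) = B y x) {e f : V} {θ₀ : K}
    (hef : B e f = θ₀) (hθ : σ θ₀ = -θ₀) : B f e = -θ₀ := by rw [← hB e f, hef, hθ]

/-- **Decomposition**: `y + (B f y / θ₀) e − (B e y / θ₀) f` is orthogonal to `e` and to `f`. [folklore] -/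
private theorem proj_orth (B : V →ₛₗ[σ] V →ₗ[K] K) (hB : ∀ x y, σ (B x y) = B y x) {e f : V} {θ₀ : K}
    (he : B e e = 0) (hf : B f f = 0) (hef : B e f = θ₀) (hθ : σ θ₀ = -θ₀) (hθ0 : θ₀ ≠ 0) (y : V) :
    B e (y + (B f y * θ₀⁻¹) • e - (B e y * θ₀⁻¹) • f) = 0 ∧
      B f (y + (B f y * θ₀⁻¹) • e - (B e y * θ₀⁻¹) • f) = 0 := by
  have hfe := apply_fe B hB hef hθ
  constructor
  · rw [map_sub, map_add, apply_smul_right, apply_smul_right, he, hef, mul_zero, add_zero,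
      inv_mul_cancel_right₀ hθ0, sub_self]
  · rw [map_sub, map_add, apply_smul_right, apply_smul_right, hf, hfe, mul_zero, sub_zero, mul_neg,
      inv_mul_cancel_right₀ hθ0, add_neg_cancel]

/-- **Extensionality along a hyperbolic pair**: two endomorphisms agreeing on `e`, on `f` and on `{e, f}^⊥`
are equal. [folklore] -/
private theorem ext_of_pair (B : V →ₛₗ[σ] V →ₗ[K] K) (hB : ∀ x y, σ (B x y) = B y x) {e f : V} {θ₀ : K}
    (he : B e e = 0) (hf : B f f = 0) (hef : B e f = θ₀) (hθ : σ θ₀ = -θ₀) (hθ0 : θ₀ ≠ 0)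
    (T₁ T₂ : Module.End K V) (h₁ : T₁ e = T₂ e) (h₂ : T₁ f = T₂ f)
    (h₃ : ∀ w, B e w = 0 → B f w = 0 → T₁ w = T₂ w) : T₁ = T₂ := by
  ext y
  obtain ⟨h1, h2⟩ := proj_orth B hB he hf hef hθ hθ0 y
  have hw := h₃ _ h1 h2
  rw [map_sub, map_add, map_smul, map_smul, map_sub, map_add, map_smul, map_smul, h₁, h₂] at hw
  calc T₁ y = (T₁ y + (B f y * θ₀⁻¹) • T₂ e - (B e y * θ₀⁻¹) • T₂ f) - (B f y * θ₀⁻¹) • T₂ e +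
      (B e y * θ₀⁻¹) • T₂ f := by abel
    _ = (T₂ y + (B f y * θ₀⁻¹) • T₂ e - (B e y * θ₀⁻¹) • T₂ f) - (B f y * θ₀⁻¹) • T₂ e +
      (B e y * θ₀⁻¹) • T₂ f := by rw [hw]
    _ = T₂ y := by abel

/-- **The complement `{e, f}^⊥` is non-degenerate**: a vector orthogonal to `e`, `f` and to `{e, f}^⊥` is `0`
(`B` non-degenerate). [folklore] -/
private theorem eq_zero_of_orth (B : V →ₛₗ[σ] V →ₗ[K] K) (hB : ∀ x y, σ (B x y) = B y x)
    (hBnd : ∀ x, (∀ y, B x y = 0) → x = 0) {e f : V} {θ₀ : K}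
    (he : B e e = 0) (hf : B f f = 0) (hef : B e f = θ₀) (hθ : σ θ₀ = -θ₀) (hθ0 : θ₀ ≠ 0)
    (x : V) (hxe : B e x = 0) (hxf : B f x = 0) (hx : ∀ w, B e w = 0 → B f w = 0 → B x w = 0) : x = 0 := by
  refine hBnd x fun y => ?_
  obtain ⟨h1, h2⟩ := proj_orth B hB he hf hef hθ hθ0 y
  have hw := hx _ h1 h2
  rw [map_sub, map_add, apply_smul_right, apply_smul_right, apply_eq_zero_comm B hB hxe,
    apply_eq_zero_comm B hB hxf, mul_zero, mul_zero, add_zero, sub_zero] at hw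
  exact hw

/-! ### Dilations `D(α)`: `e ↦ α e`, `f ↦ (σα)⁻¹ f`, identity on `{e, f}^⊥` -/

/-- `D(α) y = y + ((1 − α) θ₀⁻¹ B f y) • e + (((σα)⁻¹ − 1) θ₀⁻¹ B e y) • f`. [folklore] -/
private theorem dil_apply (B : V →ₛₗ[σ] V →ₗ[K] K) (e f : V) (θ₀ α : K) (y : V) :
    ((1 : Module.End K V) + ((1 - α) * θ₀⁻¹) • (B f).smulRight e + (((σ α)⁻¹ - 1) * θ₀⁻¹) • (B e).smulRight f) y
      = y + ((1 - α) * θ₀⁻¹ * B f y) • e + (((σ α)⁻¹ - 1) * θ₀⁻¹ * B e y) • f := by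
  simp only [LinearMap.add_apply, Module.End.one_apply, LinearMap.smul_apply, LinearMap.smulRight_apply,
    smul_smul]

/-- `D(α) e = α • e`. [folklore] -/
private theorem dil_apply_e (B : V →ₛₗ[σ] V →ₗ[K] K) (hB : ∀ x y, σ (B x y) = B y x) {e f : V} {θ₀ : K}
    (he : B e e = 0) (hef : B e f = θ₀) (hθ : σ θ₀ = -θ₀) (hθ0 : θ₀ ≠ 0) (α : K) :
    ((1 : Module.End K V) + ((1 - α) * θ₀⁻¹) • (B f).smulRight e + (((σ α)⁻¹ - 1) * θ₀⁻¹) • (B e).smulRight f) e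
      = α • e := by
  rw [dil_apply, he, apply_fe B hB hef hθ, mul_zero, zero_smul, add_zero, mul_neg, inv_mul_cancel_right₀ hθ0]
  nth_rw 1 [← one_smul K e]
  rw [← add_smul]
  congr 1
  ring

/-- `D(α) f = (σα)⁻¹ • f`. [folklore] -/
private theorem dil_apply_f (B : V →ₛₗ[σ] V →ₗ[K] K) {e f : V} {θ₀ : K} (hf : B f f = 0) (hef : B e f = θ₀)
    (hθ0 : θ₀ ≠ 0) (α : K) :
    ((1 : Module.End K V) + ((1 - α) * θ₀⁻¹) • (B f).smulRight e + (((σ α)⁻¹ - 1) * θ₀⁻¹) • (B e).smulRight f) f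
      = (σ α)⁻¹ • f := by
  rw [dil_apply, hf, hef, mul_zero, zero_smul, add_zero, inv_mul_cancel_right₀ hθ0]
  nth_rw 1 [← one_smul K f]
  rw [← add_smul, add_sub_cancel]

/-- `D(α) w = w` for `w ⊥ e, f`. [folklore] -/
private theorem dil_apply_of_orth (B : V →ₛₗ[σ] V →ₗ[K] K) (e f : V) (θ₀ α : K) {w : V} (hw1 : B e w = 0)
    (hw2 : B f w = 0) :
    ((1 : Module.End K V) + ((1 - α) * θ₀⁻¹) • (B f).smulRight e + (((σ α)⁻¹ - 1) * θ₀⁻¹) • (B e).smulRight f) w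
      = w := by
  rw [dil_apply, hw1, hw2, mul_zero, mul_zero, zero_smul, zero_smul, add_zero, add_zero]

/-- `D(α) D(β) = D(α β)`. [folklore] -/
private theorem dil_mul_dil (B : V →ₛₗ[σ] V →ₗ[K] K) (hB : ∀ x y, σ (B x y) = B y x)
    {e f : V} {θ₀ : K} (he : B e e = 0) (hf : B f f = 0) (hef : B e f = θ₀) (hθ : σ θ₀ = -θ₀) (hθ0 : θ₀ ≠ 0)
    (α β : K) :
    ((1 : Module.End K V) + ((1 - α) * θ₀⁻¹) • (B f).smulRight e + (((σ α)⁻¹ - 1) * θ₀⁻¹) • (B e).smulRight f) *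
        ((1 : Module.End K V) + ((1 - β) * θ₀⁻¹) • (B f).smulRight e +
          (((σ β)⁻¹ - 1) * θ₀⁻¹) • (B e).smulRight f) =
      (1 : Module.End K V) + ((1 - α * β) * θ₀⁻¹) • (B f).smulRight e +
        (((σ (α * β))⁻¹ - 1) * θ₀⁻¹) • (B e).smulRight f := by
  refine ext_of_pair B hB he hf hef hθ hθ0 _ _ ?_ ?_ ?_
  · rw [Module.End.mul_apply, dil_apply_e B hB he hef hθ hθ0, map_smul, dil_apply_e B hB he hef hθ hθ0,
      dil_apply_e B hB he hef hθ hθ0, smul_smul, mul_comm]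
  · rw [Module.End.mul_apply, dil_apply_f B hf hef hθ0, map_smul, dil_apply_f B hf hef hθ0, dil_apply_f B hf hef hθ0,
      smul_smul, map_mul, mul_inv, mul_comm]
  · intro w hw1 hw2
    rw [Module.End.mul_apply, dil_apply_of_orth B e f θ₀ β hw1 hw2, dil_apply_of_orth B e f θ₀ α hw1 hw2,
      dil_apply_of_orth B e f θ₀ _ hw1 hw2]

/-- `D(1) = 1`. [folklore] -/
private theorem dil_one (B : V →ₛₗ[σ] V →ₗ[K] K) (e f : V) (θ₀ : K) :
    ((1 : Module.End K V) + ((1 - (1 : K)) * θ₀⁻¹) • (B f).smulRight e +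
      (((σ 1)⁻¹ - 1) * θ₀⁻¹) • (B e).smulRight f) = 1 := by
  rw [map_one, inv_one, sub_self, zero_mul, zero_smul, zero_smul, add_zero, add_zero]

/-- **`D(α)` commutes with a quasi-symmetry along a vector of `{e, f}^⊥`.** [folklore] -/
private theorem dil_mul_quasi_comm (B : V →ₛₗ[σ] V →ₗ[K] K) (hB : ∀ x y, σ (B x y) = B y x) (e f : V) (θ₀ α : K)
    (b : V) (hb1 : B e b = 0) (hb2 : B f b = 0) (μ : K) :
    ((1 : Module.End K V) + ((1 - α) * θ₀⁻¹) • (B f).smulRight e + (((σ α)⁻¹ - 1) * θ₀⁻¹) • (B e).smulRight f) *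
        ((1 : Module.End K V) + ((μ - 1) * (B b b)⁻¹) • (B b).smulRight b) =
      ((1 : Module.End K V) + ((μ - 1) * (B b b)⁻¹) • (B b).smulRight b) *
        ((1 : Module.End K V) + ((1 - α) * θ₀⁻¹) • (B f).smulRight e +
          (((σ α)⁻¹ - 1) * θ₀⁻¹) • (B e).smulRight f) := by
  have hbe : B b e = 0 := apply_eq_zero_comm B hB hb1
  have hbf : B b f = 0 := apply_eq_zero_comm B hB hb2
  ext y
  rw [Module.End.mul_apply, Module.End.mul_apply, quasi_apply, dil_apply, dil_apply, quasi_apply]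
  simp only [map_add, map_smul, smul_eq_mul, hb1, hb2, hbe, hbf, mul_zero, add_zero]
  abel

/-! ## §2 Products of isometries; `ψ` multiplicative on determinant-one isometries -/

/-- Products of isometries are isometries. [folklore] -/
private theorem isometry_mul (B : V →ₛₗ[σ] V →ₗ[K] K) (g h : Module.End K V) (hg : ∀ x y, B (g x) (g y) = B x y)
    (hh : ∀ x y, B (h x) (h y) = B x y) (x y : V) : B ((g * h) x) ((g * h) y) = B x y := by
  rw [Module.End.mul_apply, Module.End.mul_apply, hg, hh]

/-- `1` is an isometry. [folklore] -/
private theorem isometry_one (B : V →ₛₗ[σ] V →ₗ[K] K) (x y : V) :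
    B ((1 : Module.End K V) x) ((1 : Module.End K V) y) = B x y := by
  rw [Module.End.one_apply, Module.End.one_apply]

/-! ### Transvections: isometry, determinant, product, rescaling, conjugation -/

/-- `T(u, 0, z)` is an isometry for `B u u = 0` and skew `z`. [folklore] -/
private theorem transv_isometry (B : V →ₛₗ[σ] V →ₗ[K] K) (hB : ∀ x y, σ (B x y) = B y x) (u : V)
    (hu : B u u = 0) (z : K) (hz : z + σ z = 0) (x y : V) :
    B (((1 : Module.End K V) + (B u).smulRight (0 : V) + (z • B u - B (0 : V)).smulRight u) x)
      (((1 : Module.End K V) + (B u).smulRight (0 : V) + (z • B u - B (0 : V)).smulRight u) y) = B x y :=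
  root_isometry B hB u 0 z hu (map_zero _) (by simp only [map_zero, add_zero]; exact hz) x y

/-- `det T(u, 0, z) = 1` for `B u u = 0`. [folklore] -/
private theorem det_transv [FiniteDimensional K V] (B : V →ₛₗ[σ] V →ₗ[K] K) (hB : ∀ x y, σ (B x y) = B y x)
    (u : V) (hu : B u u = 0) (z : K) :
    LinearMap.det ((1 : Module.End K V) + (B u).smulRight (0 : V) + (z • B u - B (0 : V)).smulRight u) = 1 :=
  det_root B hB u 0 z hu (map_zero _)

/-- `T(u, 0, z) T(u, 0, z') = T(u, 0, z + z')`. [folklore] -/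
private theorem transv_mul_transv (B : V →ₛₗ[σ] V →ₗ[K] K) (u : V) (hu : B u u = 0) (z z' : K) :
    ((1 : Module.End K V) + (B u).smulRight (0 : V) + (z • B u - B (0 : V)).smulRight u) *
        ((1 : Module.End K V) + (B u).smulRight (0 : V) + (z' • B u - B (0 : V)).smulRight u) =
      (1 : Module.End K V) + (B u).smulRight (0 : V) + ((z + z') • B u - B (0 : V)).smulRight u := by
  ext y
  simp only [Module.End.mul_apply, transv_apply, map_add, map_smul, hu, mul_zero]
  module

/-- `T(β u, 0, z) = T(u, 0, (σβ β) z)`. [folklore] -/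
private theorem transv_smul_eq (B : V →ₛₗ[σ] V →ₗ[K] K) (u : V) (z β : K) :
    ((1 : Module.End K V) + (B (β • u)).smulRight (0 : V) + (z • B (β • u) - B (0 : V)).smulRight (β • u)) =
      (1 : Module.End K V) + (B u).smulRight (0 : V) + (((σ β * β) * z) • B u - B (0 : V)).smulRight u := by
  ext y
  rw [transv_apply, transv_apply]
  simp only [LinearMap.map_smulₛₗ, LinearMap.smul_apply, smul_eq_mul, smul_smul]
  ring_nf

/-- `g T(u, 0, z) g' = T(g u, 0, z)` for an isometry `g` with `g g' = 1`. [folklore] -/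
private theorem conj_transv (B : V →ₛₗ[σ] V →ₗ[K] K) (g g' : Module.End K V)
    (hg : ∀ x y, B (g x) (g y) = B x y) (hgg' : g * g' = 1) (u : V) (z : K) :
    g * ((1 : Module.End K V) + (B u).smulRight (0 : V) + (z • B u - B (0 : V)).smulRight u) * g' =
      (1 : Module.End K V) + (B (g u)).smulRight (0 : V) + (z • B (g u) - B (0 : V)).smulRight (g u) := by
  ext y
  have hy : g (g' y) = y := by rw [← Module.End.mul_apply, hgg', Module.End.one_apply]
  rw [Module.End.mul_apply, Module.End.mul_apply, transv_apply, transv_apply, map_add, map_smul, hy]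
  have h1 : B u (g' y) = B (g u) y := by conv_rhs => rw [← hy]; rw [hg]
  rw [h1]

/-- `T(−u, w, z) = T(u, −w, z)`. [folklore] -/
private theorem root_neg_eq (B : V →ₛₗ[σ] V →ₗ[K] K) (u w : V) (z : K) :
    ((1 : Module.End K V) + (B (-u)).smulRight w + (z • B (-u) - B w).smulRight (-u)) =
      (1 : Module.End K V) + (B u).smulRight (-w) + (z • B u - B (-w)).smulRight u := by
  ext y
  rw [root_apply, root_apply]
  simp only [map_neg, LinearMap.neg_apply, smul_neg, neg_smul, mul_neg, sub_neg_eq_add]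
  module

section Psi

variable {A : Type*} [CommGroup A] (B : V →ₛₗ[σ] V →ₗ[K] K) (ψ : Module.End K V → A)
  (hψ : ∀ g h : Module.End K V, (∀ x y, B (g x) (g y) = B x y) → (∀ x y, B (h x) (h y) = B x y) →
    LinearMap.det g = 1 → LinearMap.det h = 1 → ψ (g * h) = ψ g * ψ h)
include hψ

/-- `ψ 1 = 1`. [folklore] -/
private theorem psi_one : ψ 1 = 1 := by
  have h := hψ 1 1 (isometry_one B) (isometry_one B) LinearMap.det.map_one LinearMap.det.map_one
  rw [mul_one] at h
  exact left_eq_mul.1 h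

/-- `ψ g * ψ g' = 1` for determinant-one isometries `g, g'` with `g g' = 1`. [folklore] -/
private theorem psi_mul_inv (g g' : Module.End K V) (hg : ∀ x y, B (g x) (g y) = B x y)
    (hg' : ∀ x y, B (g' x) (g' y) = B x y) (hdg : LinearMap.det g = 1) (hdg' : LinearMap.det g' = 1)
    (hgg' : g * g' = 1) : ψ g * ψ g' = 1 := by
  rw [← hψ g g' hg hg' hdg hdg', hgg', psi_one B ψ hψ]

/-- **Conjugation invariance under determinant-one isometries**: `ψ (g t g') = ψ t`. [folklore] -/
private theorem psi_conj (g t g' : Module.End K V) (hg : ∀ x y, B (g x) (g y) = B x y)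
    (ht : ∀ x y, B (t x) (t y) = B x y) (hg' : ∀ x y, B (g' x) (g' y) = B x y) (hdg : LinearMap.det g = 1)
    (hdt : LinearMap.det t = 1) (hdg' : LinearMap.det g' = 1) (hgg' : g * g' = 1) :
    ψ (g * t * g') = ψ t := by
  have hdgt : LinearMap.det (g * t) = 1 := by rw [map_mul, hdg, hdt, one_mul]
  rw [hψ _ _ (isometry_mul B g t hg ht) hg' hdgt hdg', hψ _ _ hg ht hdg hdt, mul_right_comm,
    psi_mul_inv B ψ hψ g g' hg hg' hdg hdg' hgg', one_mul]

/-- `ψ` of a product of three determinant-one isometries. [folklore] -/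
private theorem psi_mul_three (g h k : Module.End K V) (hg : ∀ x y, B (g x) (g y) = B x y)
    (hh : ∀ x y, B (h x) (h y) = B x y) (hk : ∀ x y, B (k x) (k y) = B x y) (hdg : LinearMap.det g = 1)
    (hdh : LinearMap.det h = 1) (hdk : LinearMap.det k = 1) :
    ψ (g * h * k) = ψ g * ψ h * ψ k := by
  have hdgh : LinearMap.det (g * h) = 1 := by rw [map_mul, hdg, hdh, one_mul]
  rw [hψ _ _ (isometry_mul B g h hg hh) hk hdgh hdk, hψ _ _ hg hh hdg hdh]

/-- `ψ` of a product of four determinant-one isometries. [folklore] -/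
private theorem psi_mul_four (g h k l : Module.End K V) (hg : ∀ x y, B (g x) (g y) = B x y)
    (hh : ∀ x y, B (h x) (h y) = B x y) (hk : ∀ x y, B (k x) (k y) = B x y)
    (hl : ∀ x y, B (l x) (l y) = B x y) (hdg : LinearMap.det g = 1)
    (hdh : LinearMap.det h = 1) (hdk : LinearMap.det k = 1) (hdl : LinearMap.det l = 1) :
    ψ (g * h * k * l) = ψ g * ψ h * ψ k * ψ l := by
  have hdghk : LinearMap.det (g * h * k) = 1 := by rw [map_mul, map_mul, hdg, hdh, hdk, one_mul, one_mul]
  rw [hψ _ _ (isometry_mul B _ k (isometry_mul B g h hg hh) hk) hl hdghk hdl,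
    psi_mul_three B ψ hψ g h k hg hh hk hdg hdh hdk]

/-! ### Killing transvections and root elements by conjugation with DETERMINANT-ONE isometries -/

variable [FiniteDimensional K V]

/-- **Transvections are killed**: if some DETERMINANT-ONE isometry rescales the isotropic `u` by `β` with
`σβ·β ≠ 1`, then `ψ (T(u, 0, ζ)) = 1` for every `ζ` with `ζ + σ ζ = 0`.
[cite: Dieudonne1971GroupesClassiques, Chap. II §5] -/
theorem psi_transv (hB : ∀ x y, σ (B x y) = B y x) (hσ : ∀ x, σ (σ x) = x) (u : V) (hu : B u u = 0)
    (β : K) (hβ : σ β * β ≠ 1) (g g' : Module.End K V) (hg : ∀ x y, B (g x) (g y) = B x y)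
    (hg' : ∀ x y, B (g' x) (g' y) = B x y) (hdg : LinearMap.det g = 1) (hdg' : LinearMap.det g' = 1)
    (hgg' : g * g' = 1) (hgu : g u = β • u) (ζ : K) (hζ : ζ + σ ζ = 0) :
    ψ ((1 : Module.End K V) + (B u).smulRight (0 : V) + (ζ • B u - B (0 : V)).smulRight u) = 1 := by
  have hiso := transv_isometry B hB u hu
  have hdet := det_transv B hB u hu
  have hN : σ (σ β * β) = σ β * β := by rw [map_mul, hσ, mul_comm]
  -- step 1: `ψ T(u, 0, N z) = ψ T(u, 0, z)` for skew `z`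
  have step1 : ∀ z : K, z + σ z = 0 →
      ψ ((1 : Module.End K V) + (B u).smulRight (0 : V) + (((σ β * β) * z) • B u - B (0 : V)).smulRight u) =
        ψ ((1 : Module.End K V) + (B u).smulRight (0 : V) + (z • B u - B (0 : V)).smulRight u) := by
    intro z hz
    have hc := conj_transv B g g' hg hgg' u z
    rw [hgu, transv_smul_eq B u z β] at hc
    rw [← hc, psi_conj B ψ hψ g _ g' hg (hiso z hz) hg' hdg (hdet z) hdg' hgg']
  -- step 2: `ψ T(u, 0, (N − 1) z) = 1` for skew `z`
  have step2 : ∀ z : K, z + σ z = 0 →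
      ψ ((1 : Module.End K V) + (B u).smulRight (0 : V) + (((σ β * β - 1) * z) • B u - B (0 : V)).smulRight u)
        = 1 := by
    intro z hz
    have hzN : (σ β * β) * z + σ ((σ β * β) * z) = 0 := by
      rw [map_mul, hN, ← mul_add, hz, mul_zero]
    have hzn : -z + σ (-z) = 0 := by rw [map_neg, ← neg_add, hz, neg_zero]
    have e1 : (σ β * β - 1) * z = σ β * β * z + -z := by ring
    rw [e1, ← transv_mul_transv B u hu, hψ _ _ (hiso _ hzN) (hiso _ hzn) (hdet _) (hdet _), step1 z hz,
      ← hψ _ _ (hiso _ hz) (hiso _ hzn) (hdet _) (hdet _), transv_mul_transv B u hu, add_neg_cancel, root_zero,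
      psi_one B ψ hψ]
  -- step 3: every skew `ζ` is `(N − 1) z` with `z` skew
  have hN1 : σ β * β - 1 ≠ 0 := sub_ne_zero.2 hβ
  have e2 : ζ = (σ β * β - 1) * (ζ * (σ β * β - 1)⁻¹) := by field_simp
  rw [e2]
  refine step2 _ ?_
  rw [map_mul, map_inv₀, map_sub, hN, map_one, ← add_mul, hζ, zero_mul]

/-- **Root elements are killed**: with a determinant-one rescaling isometry as in `psi_transv` and a
determinant-one isometry negating `u` and fixing `w`, `ψ (T(u, w, z)) = 1` for every admissible `(w, z)` (`2 ≠ 0`).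
[cite: Dieudonne1971GroupesClassiques, Chap. II §5] -/
theorem psi_root (hB : ∀ x y, σ (B x y) = B y x) (hσ : ∀ x, σ (σ x) = x) (h2 : (2 : K) ≠ 0) (u : V)
    (hu : B u u = 0) (β : K) (hβ : σ β * β ≠ 1) (g g' : Module.End K V) (hg : ∀ x y, B (g x) (g y) = B x y)
    (hg' : ∀ x y, B (g' x) (g' y) = B x y) (hdg : LinearMap.det g = 1) (hdg' : LinearMap.det g' = 1)
    (hgg' : g * g' = 1) (hgu : g u = β • u)
    (n n' : Module.End K V) (hn : ∀ x y, B (n x) (n y) = B x y) (hn' : ∀ x y, B (n' x) (n' y) = B x y)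
    (hdn : LinearMap.det n = 1) (hdn' : LinearMap.det n' = 1)
    (hnn' : n * n' = 1) (hnu : n u = -u) (w : V) (huw : B u w = 0) (hnw : n w = w) (z : K)
    (hz : z + σ z + B w w = 0) :
    ψ ((1 : Module.End K V) + (B u).smulRight w + (z • B u - B w).smulRight u) = 1 := by
  have h2σ : σ 2 = 2 := map_ofNat σ 2
  have h22 : (2 : K)⁻¹ * 2 = 1 := inv_mul_cancel₀ h2
  have hww : σ (B w w) = B w w := hB w w
  have hiso : ∀ (w' : V) (z' : K), B u w' = 0 → z' + σ z' + B w' w' = 0 → ∀ x y,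
      B (((1 : Module.End K V) + (B u).smulRight w' + (z' • B u - B w').smulRight u) x)
        (((1 : Module.End K V) + (B u).smulRight w' + (z' • B u - B w').smulRight u) y) = B x y :=
    fun w' z' h1 h3 => root_isometry B hB u w' z' hu h1 h3
  have hdet : ∀ (w' : V) (z' : K), B u w' = 0 →
      LinearMap.det ((1 : Module.End K V) + (B u).smulRight w' + (z' • B u - B w').smulRight u) = 1 :=
    fun w' z' h1 => det_root B hB u w' z' hu h1
  -- (i) negating `u`: `ψ T(u, −w', z') = ψ T(u, w', z')`
  have neg_eq : ∀ (w' : V) (z' : K), B u w' = 0 → n w' = w' → z' + σ z' + B w' w' = 0 →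
      ψ ((1 : Module.End K V) + (B u).smulRight (-w') + (z' • B u - B (-w')).smulRight u) =
        ψ ((1 : Module.End K V) + (B u).smulRight w' + (z' • B u - B w').smulRight u) := by
    intro w' z' h1 hnw' h3
    have hc := conj_root B n n' hn hnn' u w' z'
    rw [hnw', hnu, root_neg_eq B u w' z'] at hc
    rw [← hc, psi_conj B ψ hψ n _ n' hn (hiso w' z' h1 h3) hn' hdn (hdet w' z' h1) hdn' hnn']
  -- (ii) the square of the canonical root element on `w'` is killed
  have sq_eq : ∀ w' : V, B u w' = 0 → n w' = w' →
      ψ (((1 : Module.End K V) + (B u).smulRight w' + ((-(B w' w') * 2⁻¹) • B u - B w').smulRight u) *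
        ((1 : Module.End K V) + (B u).smulRight w' + ((-(B w' w') * 2⁻¹) • B u - B w').smulRight u)) = 1 := by
    intro w' h1 hnw'
    have hfix : σ (-(B w' w') * 2⁻¹) = -(B w' w') * 2⁻¹ := by
      rw [map_mul, map_neg, map_inv₀, h2σ, hB w' w']
    have hadm : -(B w' w') * 2⁻¹ + σ (-(B w' w') * 2⁻¹) + B w' w' = 0 := by
      rw [hfix]; linear_combination (-(B w' w')) * h22
    have hadm' : -(B w' w') * 2⁻¹ + σ (-(B w' w') * 2⁻¹) + B (-w') (-w') = 0 := by
      simp only [map_neg, LinearMap.neg_apply, neg_neg]; exact hadm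
    have h1n : B u (-w') = 0 := by rw [map_neg, h1, neg_zero]
    have hn2 := neg_eq w' (-(B w' w') * 2⁻¹) h1 hnw' hadm
    have hinv := root_mul_root_neg B hB u w' (-(B w' w') * 2⁻¹) hu h1 hadm
    rw [hfix] at hinv
    rw [hψ _ _ (hiso w' _ h1 hadm) (hiso w' _ h1 hadm) (hdet w' _ h1) (hdet w' _ h1)]
    nth_rw 2 [← hn2]
    rw [← hψ _ _ (hiso w' _ h1 hadm) (hiso (-w') _ h1n hadm') (hdet w' _ h1) (hdet (-w') _ h1n), hinv,
      psi_one B ψ hψ]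
  -- (iii) the canonical root element on `w` is killed (apply (ii) to `w/2`)
  have hcan : ψ ((1 : Module.End K V) + (B u).smulRight w +
      ((-(B w w) * 2⁻¹) • B u - B w).smulRight u) = 1 := by
    have h1 : B u ((2⁻¹ : K) • w) = 0 := by rw [map_smul, huw, smul_zero]
    have h := sq_eq ((2⁻¹ : K) • w) h1 (by rw [map_smul, hnw])
    rw [root_mul_root B hB u _ _ _ _ hu h1 h1] at h
    have e1 : (2⁻¹ : K) • w + (2⁻¹ : K) • w = w := by
      rw [← add_smul, ← mul_two, h22, one_smul]
    have e2 : -(B ((2⁻¹ : K) • w) ((2⁻¹ : K) • w)) * 2⁻¹ + -(B ((2⁻¹ : K) • w) ((2⁻¹ : K) • w)) * 2⁻¹ -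
        B ((2⁻¹ : K) • w) ((2⁻¹ : K) • w) = -(B w w) * 2⁻¹ := by
      rw [apply_smul_left, apply_smul_right, map_inv₀, h2σ]
      linear_combination (-(2⁻¹ : K) * B w w * (2⁻¹ + 1)) * h22
    rwa [e1, e2] at h
  -- (iv) split off a transvection
  have hζs : (z + B w w * 2⁻¹) + σ (z + B w w * 2⁻¹) = 0 := by
    rw [map_add, map_mul, map_inv₀, h2σ, hww]
    linear_combination hz + (B w w) * h22
  have hsplit : ((1 : Module.End K V) + (B u).smulRight w + ((-(B w w) * 2⁻¹) • B u - B w).smulRight u) *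
      ((1 : Module.End K V) + (B u).smulRight (0 : V) + ((z + B w w * 2⁻¹) • B u - B (0 : V)).smulRight u) =
      (1 : Module.End K V) + (B u).smulRight w + (z • B u - B w).smulRight u := by
    have hwu : B w u = 0 := apply_eq_zero_comm B hB huw
    ext y
    rw [Module.End.mul_apply, transv_apply, root_apply, root_apply]
    simp only [map_add, map_smul, smul_eq_mul, hu, hwu, mul_zero, add_zero]
    module
  have hadm0 : -(B w w) * 2⁻¹ + σ (-(B w w) * 2⁻¹) + B w w = 0 := by
    rw [map_mul, map_neg, map_inv₀, h2σ, hww]; linear_combination (-(B w w)) * h22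
  rw [← hsplit, hψ _ _ (hiso w _ huw hadm0) (transv_isometry B hB u hu _ hζs) (hdet w _ huw)
    (det_transv B hB u hu _), hcan, one_mul]
  exact psi_transv B ψ hψ hB hσ u hu β hβ g g' hg hg' hdg hdg' hgg' hgu _ hζs

end Psi

/-! ## §3 The hyperbolic plane: root elements on `e`, `f` are killed; the `SL₂(K^σ)` identity -/

/-- `T(e, 0, ζ) (a e + b f) = (a + ζ θ₀ b) e + b f`. [folklore] -/
private theorem transv_e_apply_pair (B : V →ₛₗ[σ] V →ₗ[K] K) {e f : V} {θ₀ : K} (he : B e e = 0) (hef : B e f = θ₀)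
    (ζ a b : K) :
    ((1 : Module.End K V) + (B e).smulRight (0 : V) + (ζ • B e - B (0 : V)).smulRight e) (a • e + b • f) =
      (a + ζ * θ₀ * b) • e + b • f := by
  rw [transv_apply, map_add, map_smul, map_smul, he, hef, smul_zero, zero_add, smul_eq_mul]
  module

/-- `T(f, 0, ζ) (a e + b f) = a e + (b − ζ θ₀ a) f`. [folklore] -/
private theorem transv_f_apply_pair (B : V →ₛₗ[σ] V →ₗ[K] K) (hB : ∀ x y, σ (B x y) = B y x) {e f : V} {θ₀ : K}
    (hf : B f f = 0) (hef : B e f = θ₀) (hθ : σ θ₀ = -θ₀) (ζ a b : K) :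
    ((1 : Module.End K V) + (B f).smulRight (0 : V) + (ζ • B f - B (0 : V)).smulRight f) (a • e + b • f) =
      a • e + (b - ζ * θ₀ * a) • f := by
  rw [transv_apply, map_add, map_smul, map_smul, hf, apply_fe B hB hef hθ, smul_zero, add_zero, smul_eq_mul]
  module

/-- `D(α) (a e + b f) = (α a) e + ((σα)⁻¹ b) f`. [folklore] -/
private theorem dil_apply_pair (B : V →ₛₗ[σ] V →ₗ[K] K) (hB : ∀ x y, σ (B x y) = B y x) {e f : V} {θ₀ : K}
    (he : B e e = 0) (hf : B f f = 0) (hef : B e f = θ₀) (hθ : σ θ₀ = -θ₀) (hθ0 : θ₀ ≠ 0) (α a b : K) :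
    ((1 : Module.End K V) + ((1 - α) * θ₀⁻¹) • (B f).smulRight e + (((σ α)⁻¹ - 1) * θ₀⁻¹) • (B e).smulRight f)
        (a • e + b • f) = (α * a) • e + ((σ α)⁻¹ * b) • f := by
  rw [map_add, map_smul, map_smul, dil_apply_e B hB he hef hθ hθ0, dil_apply_f B hf hef hθ0, smul_smul, smul_smul,
    mul_comm a, mul_comm b]

section PlanePsi

variable [FiniteDimensional K V] {A : Type*} [CommGroup A] (B : V →ₛₗ[σ] V →ₗ[K] K) (ψ : Module.End K V → A)
  (hψ : ∀ g h : Module.End K V, (∀ x y, B (g x) (g y) = B x y) → (∀ x y, B (h x) (h y) = B x y) →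
    LinearMap.det g = 1 → LinearMap.det h = 1 → ψ (g * h) = ψ g * ψ h)
  (hB : ∀ x y, σ (B x y) = B y x) (hσ : ∀ x, σ (σ x) = x) (h2 : (2 : K) ≠ 0)
  {e f : V} {θ₀ : K} (he : B e e = 0) (hf : B f f = 0) (hef : B e f = θ₀) (hθ : σ θ₀ = -θ₀) (hθ0 : θ₀ ≠ 0)
  {α : K} (hα : σ α = α) (hα0 : α ≠ 0) (hα1 : α * α ≠ 1)
include hψ hB hσ h2 he hf hef hθ hθ0 hα hα0 hα1

/-- **Root elements on `e` are killed**: `ψ (T(e, w, z)) = 1` for `w ⊥ e, f` and admissible `z` — conjugate by the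
DETERMINANT-ONE dilations `D(α)` (`σα = α`, `α² ≠ 1`) and `D(−1)` of the hyperbolic plane.
[cite: Dieudonne1971GroupesClassiques, Chap. II §5] -/
theorem psi_root_e (w : V) (hw1 : B e w = 0) (hw2 : B f w = 0) (z : K) (hz : z + σ z + B w w = 0) :
    ψ ((1 : Module.End K V) + (B e).smulRight w + (z • B e - B w).smulRight e) = 1 := by
  have hDiso : ∀ γ : K, γ ≠ 0 → ∀ x y, B (((1 : Module.End K V) + ((1 - γ) * θ₀⁻¹) • (B f).smulRight e +
      (((σ γ)⁻¹ - 1) * θ₀⁻¹) • (B e).smulRight f) x) (((1 : Module.End K V) + ((1 - γ) * θ₀⁻¹) • (B f).smulRight e +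
      (((σ γ)⁻¹ - 1) * θ₀⁻¹) • (B e).smulRight f) y) = B x y :=
    fun γ hγ => dil_isometry B hB hσ he hf hef hθ hθ0 γ hγ
  have hDinv : ∀ γ : K, γ ≠ 0 → ((1 : Module.End K V) + ((1 - γ) * θ₀⁻¹) • (B f).smulRight e +
      (((σ γ)⁻¹ - 1) * θ₀⁻¹) • (B e).smulRight f) * ((1 : Module.End K V) + ((1 - γ⁻¹) * θ₀⁻¹) • (B f).smulRight e +
      (((σ γ⁻¹)⁻¹ - 1) * θ₀⁻¹) • (B e).smulRight f) = 1 := by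
    intro γ hγ
    rw [dil_mul_dil B hB he hf hef hθ hθ0, mul_inv_cancel₀ hγ, dil_one]
  have hDdet : ∀ γ : K, γ ≠ 0 → σ γ = γ → LinearMap.det ((1 : Module.End K V) + ((1 - γ) * θ₀⁻¹) • (B f).smulRight e +
      (((σ γ)⁻¹ - 1) * θ₀⁻¹) • (B e).smulRight f) = 1 := by
    intro γ hγ hσγ
    rw [det_dil B hB hf hef hθ hθ0, hσγ, mul_inv_cancel₀ hγ]
  have hn0 : (-1 : K) ≠ 0 := neg_ne_zero.2 one_ne_zero
  have hσn : σ (-1 : K) = -1 := by rw [map_neg, map_one]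
  have hαi : σ α⁻¹ = α⁻¹ := by rw [map_inv₀, hα]
  have hni : σ (-1 : K)⁻¹ = (-1)⁻¹ := by rw [map_inv₀, hσn]
  have hβ : σ α * α ≠ 1 := by rwa [hα]
  refine psi_root B ψ hψ hB hσ h2 e he α hβ _ _ (hDiso α hα0) (hDiso α⁻¹ (inv_ne_zero hα0))
    (hDdet α hα0 hα) (hDdet α⁻¹ (inv_ne_zero hα0) hαi) (hDinv α hα0)
    (dil_apply_e B hB he hef hθ hθ0 α) _ _ (hDiso (-1) hn0) (hDiso (-1)⁻¹ (inv_ne_zero hn0)) (hDdet (-1) hn0 hσn)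
    (hDdet (-1)⁻¹ (inv_ne_zero hn0) hni) (hDinv (-1) hn0) ?_ w hw1 ?_ z hz
  · rw [dil_apply_e B hB he hef hθ hθ0, neg_one_smul]
  · exact dil_apply_of_orth B e f θ₀ (-1) hw1 hw2

/-- **Root elements on `f` are killed**: `ψ (T(f, w, z)) = 1` for `w ⊥ e, f` and admissible `z`.
[cite: Dieudonne1971GroupesClassiques, Chap. II §5] -/
theorem psi_root_f (w : V) (hw1 : B e w = 0) (hw2 : B f w = 0) (z : K) (hz : z + σ z + B w w = 0) :
    ψ ((1 : Module.End K V) + (B f).smulRight w + (z • B f - B w).smulRight f) = 1 := by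
  have hDiso : ∀ γ : K, γ ≠ 0 → ∀ x y, B (((1 : Module.End K V) + ((1 - γ) * θ₀⁻¹) • (B f).smulRight e +
      (((σ γ)⁻¹ - 1) * θ₀⁻¹) • (B e).smulRight f) x) (((1 : Module.End K V) + ((1 - γ) * θ₀⁻¹) • (B f).smulRight e +
      (((σ γ)⁻¹ - 1) * θ₀⁻¹) • (B e).smulRight f) y) = B x y :=
    fun γ hγ => dil_isometry B hB hσ he hf hef hθ hθ0 γ hγ
  have hDinv : ∀ γ : K, γ ≠ 0 → ((1 : Module.End K V) + ((1 - γ) * θ₀⁻¹) • (B f).smulRight e +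
      (((σ γ)⁻¹ - 1) * θ₀⁻¹) • (B e).smulRight f) * ((1 : Module.End K V) + ((1 - γ⁻¹) * θ₀⁻¹) • (B f).smulRight e +
      (((σ γ⁻¹)⁻¹ - 1) * θ₀⁻¹) • (B e).smulRight f) = 1 := by
    intro γ hγ
    rw [dil_mul_dil B hB he hf hef hθ hθ0, mul_inv_cancel₀ hγ, dil_one]
  have hDdet : ∀ γ : K, γ ≠ 0 → σ γ = γ → LinearMap.det ((1 : Module.End K V) + ((1 - γ) * θ₀⁻¹) • (B f).smulRight e +
      (((σ γ)⁻¹ - 1) * θ₀⁻¹) • (B e).smulRight f) = 1 := by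
    intro γ hγ hσγ
    rw [det_dil B hB hf hef hθ hθ0, hσγ, mul_inv_cancel₀ hγ]
  have hn0 : (-1 : K) ≠ 0 := neg_ne_zero.2 one_ne_zero
  have hσn : σ (-1 : K) = -1 := by rw [map_neg, map_one]
  have hαi : σ α⁻¹ = α⁻¹ := by rw [map_inv₀, hα]
  have hni : σ (-1 : K)⁻¹ = (-1)⁻¹ := by rw [map_inv₀, hσn]
  have hβ : σ (σ α)⁻¹ * (σ α)⁻¹ ≠ 1 := by
    rw [hα, hαi]
    intro h
    apply hα1
    have h' : α * α * (α⁻¹ * α⁻¹) = α * α * 1 := by rw [h]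
    rw [mul_one] at h'
    rw [← h']
    field_simp
  refine psi_root B ψ hψ hB hσ h2 f hf (σ α)⁻¹ hβ _ _ (hDiso α hα0) (hDiso α⁻¹ (inv_ne_zero hα0))
    (hDdet α hα0 hα) (hDdet α⁻¹ (inv_ne_zero hα0) hαi) (hDinv α hα0)
    (dil_apply_f B hf hef hθ0 α) _ _ (hDiso (-1) hn0) (hDiso (-1)⁻¹ (inv_ne_zero hn0)) (hDdet (-1) hn0 hσn)
    (hDdet (-1)⁻¹ (inv_ne_zero hn0) hni) (hDinv (-1) hn0) ?_ w hw2 ?_ z hz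
  · rw [dil_apply_f B hf hef hθ0, hσn, inv_neg, inv_one, neg_one_smul]
  · exact dil_apply_of_orth B e f θ₀ (-1) hw1 hw2

/-- Transvections on `e` are killed: `ψ (T(e, 0, ζ)) = 1` for skew `ζ`. [cite: Dieudonne1971GroupesClassiques, Chap. II §5] -/
theorem psi_transv_e (ζ : K) (hζ : ζ + σ ζ = 0) :
    ψ ((1 : Module.End K V) + (B e).smulRight (0 : V) + (ζ • B e - B (0 : V)).smulRight e) = 1 :=
  psi_root_e B ψ hψ hB hσ h2 he hf hef hθ hθ0 hα hα0 hα1 0 (map_zero _) (map_zero _) ζ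
    (by simp only [map_zero, add_zero]; exact hζ)

/-- Transvections on `f` are killed: `ψ (T(f, 0, ζ)) = 1` for skew `ζ`. [cite: Dieudonne1971GroupesClassiques, Chap. II §5] -/
theorem psi_transv_f (ζ : K) (hζ : ζ + σ ζ = 0) :
    ψ ((1 : Module.End K V) + (B f).smulRight (0 : V) + (ζ • B f - B (0 : V)).smulRight f) = 1 :=
  psi_root_f B ψ hψ hB hσ h2 he hf hef hθ hθ0 hα hα0 hα1 0 (map_zero _) (map_zero _) ζ
    (by simp only [map_zero, add_zero]; exact hζ)

/-- **The `SL₂(K^σ)` identity**: for `σ γ = γ ≠ 0`, `ψ (D(γ)) = 1` — because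
`D(γ) · U(1) L(1) U(1) = U(γ) L(γ⁻¹) U(γ)` with `U(t) = T(e, 0, t θ₀⁻¹)`, `L(t) = T(f, 0, t θ₀⁻¹)`, all of determinant one and
all killed. [cite: Dieudonne1971GroupesClassiques, Chap. II §5] -/
theorem psi_dil_of_fixed (γ : K) (hγ : σ γ = γ) (hγ0 : γ ≠ 0) :
    ψ ((1 : Module.End K V) + ((1 - γ) * θ₀⁻¹) • (B f).smulRight e +
      (((σ γ)⁻¹ - 1) * θ₀⁻¹) • (B e).smulRight f) = 1 := by
  have hfe := apply_fe B hB hef hθ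
  -- skewness of the parameters
  have hsk : ∀ t : K, σ t = t → t * θ₀⁻¹ + σ (t * θ₀⁻¹) = 0 := by
    intro t ht; rw [map_mul, map_inv₀, ht, hθ, inv_neg]; ring
  have hisoE : ∀ t : K, σ t = t → ∀ x y, B (((1 : Module.End K V) + (B e).smulRight (0 : V) +
      ((t * θ₀⁻¹) • B e - B (0 : V)).smulRight e) x) (((1 : Module.End K V) + (B e).smulRight (0 : V) +
      ((t * θ₀⁻¹) • B e - B (0 : V)).smulRight e) y) = B x y :=
    fun t ht => transv_isometry B hB e he _ (hsk t ht)
  have hisoF : ∀ t : K, σ t = t → ∀ x y, B (((1 : Module.End K V) + (B f).smulRight (0 : V) +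
      ((t * θ₀⁻¹) • B f - B (0 : V)).smulRight f) x) (((1 : Module.End K V) + (B f).smulRight (0 : V) +
      ((t * θ₀⁻¹) • B f - B (0 : V)).smulRight f) y) = B x y :=
    fun t ht => transv_isometry B hB f hf _ (hsk t ht)
  have hdetE : ∀ t : K, LinearMap.det ((1 : Module.End K V) + (B e).smulRight (0 : V) +
      ((t * θ₀⁻¹) • B e - B (0 : V)).smulRight e) = 1 := fun t => det_transv B hB e he _
  have hdetF : ∀ t : K, LinearMap.det ((1 : Module.End K V) + (B f).smulRight (0 : V) +
      ((t * θ₀⁻¹) • B f - B (0 : V)).smulRight f) = 1 := fun t => det_transv B hB f hf _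
  have hDiso : ∀ x y, B (((1 : Module.End K V) + ((1 - γ) * θ₀⁻¹) • (B f).smulRight e +
      (((σ γ)⁻¹ - 1) * θ₀⁻¹) • (B e).smulRight f) x) (((1 : Module.End K V) + ((1 - γ) * θ₀⁻¹) • (B f).smulRight e +
      (((σ γ)⁻¹ - 1) * θ₀⁻¹) • (B e).smulRight f) y) = B x y := dil_isometry B hB hσ he hf hef hθ hθ0 γ hγ0
  have hDdet : LinearMap.det ((1 : Module.End K V) + ((1 - γ) * θ₀⁻¹) • (B f).smulRight e +
      (((σ γ)⁻¹ - 1) * θ₀⁻¹) • (B e).smulRight f) = 1 := by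
    rw [det_dil B hB hf hef hθ hθ0, hγ, mul_inv_cancel₀ hγ0]
  have h1 : σ (1 : K) = 1 := map_one σ
  have hγi : σ γ⁻¹ = γ⁻¹ := by rw [map_inv₀, hγ]
  -- the identity of endomorphisms
  have key : ((1 : Module.End K V) + ((1 - γ) * θ₀⁻¹) • (B f).smulRight e +
        (((σ γ)⁻¹ - 1) * θ₀⁻¹) • (B e).smulRight f) *
      ((1 : Module.End K V) + (B e).smulRight (0 : V) + (((1 : K) * θ₀⁻¹) • B e - B (0 : V)).smulRight e) *
      ((1 : Module.End K V) + (B f).smulRight (0 : V) + (((1 : K) * θ₀⁻¹) • B f - B (0 : V)).smulRight f) *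
      ((1 : Module.End K V) + (B e).smulRight (0 : V) + (((1 : K) * θ₀⁻¹) • B e - B (0 : V)).smulRight e) =
      ((1 : Module.End K V) + (B e).smulRight (0 : V) + ((γ * θ₀⁻¹) • B e - B (0 : V)).smulRight e) *
      ((1 : Module.End K V) + (B f).smulRight (0 : V) + ((γ⁻¹ * θ₀⁻¹) • B f - B (0 : V)).smulRight f) *
      ((1 : Module.End K V) + (B e).smulRight (0 : V) + ((γ * θ₀⁻¹) • B e - B (0 : V)).smulRight e) := by
    have tE : ∀ (t a b : K), ((1 : Module.End K V) + (B e).smulRight (0 : V) +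
        ((t * θ₀⁻¹) • B e - B (0 : V)).smulRight e) (a • e + b • f) = (a + t * b) • e + b • f := by
      intro t a b; rw [transv_e_apply_pair B he hef, inv_mul_cancel_right₀ hθ0]
    have tF : ∀ (t a b : K), ((1 : Module.End K V) + (B f).smulRight (0 : V) +
        ((t * θ₀⁻¹) • B f - B (0 : V)).smulRight f) (a • e + b • f) = a • e + (b - t * a) • f := by
      intro t a b; rw [transv_f_apply_pair B hB hf hef hθ, inv_mul_cancel_right₀ hθ0]
    have tD : ∀ a b : K, ((1 : Module.End K V) + ((1 - γ) * θ₀⁻¹) • (B f).smulRight e +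
        (((σ γ)⁻¹ - 1) * θ₀⁻¹) • (B e).smulRight f) (a • e + b • f) = (γ * a) • e + (γ⁻¹ * b) • f := by
      intro a b; rw [dil_apply_pair B hB he hf hef hθ hθ0, hγ]
    have hpair : ∀ a b : K,
        (((1 : Module.End K V) + ((1 - γ) * θ₀⁻¹) • (B f).smulRight e +
          (((σ γ)⁻¹ - 1) * θ₀⁻¹) • (B e).smulRight f) *
        ((1 : Module.End K V) + (B e).smulRight (0 : V) + (((1 : K) * θ₀⁻¹) • B e - B (0 : V)).smulRight e) *
        ((1 : Module.End K V) + (B f).smulRight (0 : V) + (((1 : K) * θ₀⁻¹) • B f - B (0 : V)).smulRight f) *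
        ((1 : Module.End K V) + (B e).smulRight (0 : V) + (((1 : K) * θ₀⁻¹) • B e - B (0 : V)).smulRight e))
          (a • e + b • f) =
        (((1 : Module.End K V) + (B e).smulRight (0 : V) + ((γ * θ₀⁻¹) • B e - B (0 : V)).smulRight e) *
        ((1 : Module.End K V) + (B f).smulRight (0 : V) + ((γ⁻¹ * θ₀⁻¹) • B f - B (0 : V)).smulRight f) *
        ((1 : Module.End K V) + (B e).smulRight (0 : V) + ((γ * θ₀⁻¹) • B e - B (0 : V)).smulRight e))
          (a • e + b • f) := by
      intro a b
      simp only [Module.End.mul_apply, tE, tF, tD]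
      match_scalars <;> (try field_simp) <;> ring
    refine ext_of_pair B hB he hf hef hθ hθ0 _ _ ?_ ?_ ?_
    · have h10 := hpair 1 0
      rw [one_smul, zero_smul, add_zero] at h10
      exact h10
    · have h01 := hpair 0 1
      rw [one_smul, zero_smul, zero_add] at h01
      exact h01
    · intro w hw1 hw2
      have hw0 : B (0 : V) w = 0 := by rw [map_zero, LinearMap.zero_apply]
      simp only [Module.End.mul_apply, root_apply_of_orth B e 0 _ hw1 hw0, root_apply_of_orth B f 0 _ hw2 hw0,
        dil_apply_of_orth B e f θ₀ γ hw1 hw2]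
  have hL := congrArg ψ key
  rw [psi_mul_four B ψ hψ _ _ _ _ hDiso (hisoE 1 h1) (hisoF 1 h1) (hisoE 1 h1) hDdet (hdetE 1) (hdetF 1) (hdetE 1),
    psi_mul_three B ψ hψ _ _ _ (hisoE γ hγ) (hisoF γ⁻¹ hγi) (hisoE γ hγ) (hdetE γ) (hdetF γ⁻¹) (hdetE γ),
    psi_transv_e B ψ hψ hB hσ h2 he hf hef hθ hθ0 hα hα0 hα1 _ (hsk 1 h1),
    psi_transv_f B ψ hψ hB hσ h2 he hf hef hθ hθ0 hα hα0 hα1 _ (hsk 1 h1),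
    psi_transv_e B ψ hψ hB hσ h2 he hf hef hθ hθ0 hα hα0 hα1 _ (hsk γ hγ),
    psi_transv_f B ψ hψ hB hσ h2 he hf hef hθ hθ0 hα hα0 hα1 _ (hsk γ⁻¹ hγi)] at hL
  simpa using hL

end PlanePsi

/-! ## §4 The reduction to the Levi factor (the engine's §9 with determinant bookkeeping) -/

/-- **Coordinates along a hyperbolic pair**: `x = x_W − (B f x/θ₀) e + (B e x/θ₀) f` with `x_W ⊥ e, f`. [folklore] -/
private theorem decomp_pair (B : V →ₛₗ[σ] V →ₗ[K] K) (hB : ∀ x y, σ (B x y) = B y x) {e f : V} {θ₀ : K}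
    (he : B e e = 0) (hf : B f f = 0) (hef : B e f = θ₀) (hθ : σ θ₀ = -θ₀) (hθ0 : θ₀ ≠ 0) (x : V) :
    ∃ xW : V, B e xW = 0 ∧ B f xW = 0 ∧ x = xW + (-(B f x * θ₀⁻¹)) • e + (B e x * θ₀⁻¹) • f := by
  obtain ⟨h1, h2⟩ := proj_orth B hB he hf hef hθ hθ0 x
  exact ⟨_, h1, h2, by rw [neg_smul]; abel⟩

/-- … the same with the `f`-coordinate written first. [folklore] -/
private theorem decomp_pair' (B : V →ₛₗ[σ] V →ₗ[K] K) (hB : ∀ x y, σ (B x y) = B y x) {e f : V} {θ₀ : K}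
    (he : B e e = 0) (hf : B f f = 0) (hef : B e f = θ₀) (hθ : σ θ₀ = -θ₀) (hθ0 : θ₀ ≠ 0) (x : V) :
    ∃ xW : V, B e xW = 0 ∧ B f xW = 0 ∧ x = xW + (B e x * θ₀⁻¹) • f + (-(B f x * θ₀⁻¹)) • e := by
  obtain ⟨h1, h2⟩ := proj_orth B hB he hf hef hθ hθ0 x
  exact ⟨_, h1, h2, by rw [neg_smul]; abel⟩

section Reduce

variable [FiniteDimensional K V] {A : Type*} [CommGroup A] (B : V →ₛₗ[σ] V →ₗ[K] K) (ψ : Module.End K V → A)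
  (hψ : ∀ g h : Module.End K V, (∀ x y, B (g x) (g y) = B x y) → (∀ x y, B (h x) (h y) = B x y) →
    LinearMap.det g = 1 → LinearMap.det h = 1 → ψ (g * h) = ψ g * ψ h)
  (hB : ∀ x y, σ (B x y) = B y x) (hσ : ∀ x, σ (σ x) = x) (hBnd : ∀ x, (∀ y, B x y = 0) → x = 0)
  (h2 : (2 : K) ≠ 0)
  {e f : V} {θ₀ : K} (he : B e e = 0) (hf : B f f = 0) (hef : B e f = θ₀) (hθ : σ θ₀ = -θ₀) (hθ0 : θ₀ ≠ 0)
  {α : K} (hα : σ α = α) (hα0 : α ≠ 0) (hα1 : α * α ≠ 1)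
include hψ hB hσ h2 he hf hef hθ hθ0 hα hα0 hα1

/-- **Reduction, step 1**: every non-zero isotropic `x` is moved into the line `K e` by a product `t` of at most three
root elements — an isometry of determinant `1` killed by `ψ`. [cite: Dieudonne1971GroupesClassiques, Chap. II §5] -/
theorem psi_exists_killed_apply_mem_line (hBnd : ∀ x, (∀ y, B x y = 0) → x = 0) (x : V)
    (hx0 : x ≠ 0) (hxx : B x x = 0) :
    ∃ t : Module.End K V, (∀ x y, B (t x) (t y) = B x y) ∧ ψ t = 1 ∧ LinearMap.det t = 1 ∧ ∃ p : K, t x = p • e := by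
  have hfe := apply_fe B hB hef hθ
  have hθ' : σ (-θ₀) = -(-θ₀) := by rw [map_neg, hθ]
  have hθ0' : -θ₀ ≠ 0 := neg_ne_zero.2 hθ0
  -- case A: `B f x ≠ 0`
  have caseA : ∀ x : V, B x x = 0 → B f x ≠ 0 →
      ∃ t : Module.End K V, (∀ x y, B (t x) (t y) = B x y) ∧ ψ t = 1 ∧ LinearMap.det t = 1 ∧ ∃ p : K, t x = p • e := by
    intro x hxx hfx
    obtain ⟨xW, hW1, hW2, hx⟩ := decomp_pair B hB he hf hef hθ hθ0 x
    have hc : -(B f x * θ₀⁻¹) ≠ 0 := neg_ne_zero.2 (mul_ne_zero hfx (inv_ne_zero hθ0))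
    have hxx' : B (xW + (-(B f x * θ₀⁻¹)) • e + (B e x * θ₀⁻¹) • f)
        (xW + (-(B f x * θ₀⁻¹)) • e + (B e x * θ₀⁻¹) • f) = 0 := by rw [← hx]; exact hxx
    obtain ⟨w, z, hw1, hw2, hz, hT⟩ :=
      root_to_line B hB hσ hf he hfe hθ' hθ0' xW _ _ hc hW2 hW1 hxx'
    refine ⟨_, root_isometry B hB f w z hf hw1 hz,
      psi_root_f B ψ hψ hB hσ h2 he hf hef hθ hθ0 hα hα0 hα1 w hw2 hw1 z hz,
      det_root B hB f w z hf hw1, -(B f x * θ₀⁻¹), ?_⟩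
    conv_lhs => rw [hx]
    exact hT
  -- case B: `B f x = 0`, `B e x ≠ 0`
  have caseB : ∀ x : V, B x x = 0 → B f x = 0 → B e x ≠ 0 →
      ∃ t : Module.End K V, (∀ x y, B (t x) (t y) = B x y) ∧ ψ t = 1 ∧ LinearMap.det t = 1 ∧ ∃ p : K, t x = p • e := by
    intro x hxx hfx hex
    have hsk : θ₀⁻¹ + σ θ₀⁻¹ = 0 := by rw [map_inv₀, hθ, inv_neg, add_neg_cancel]
    obtain ⟨t₀, ht₀⟩ : ∃ t : Module.End K V,
        t = (1 : Module.End K V) + (B e).smulRight (0 : V) + (θ₀⁻¹ • B e - B (0 : V)).smulRight e := ⟨_, rfl⟩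
    have ht₀i : ∀ x y, B (t₀ x) (t₀ y) = B x y := by rw [ht₀]; exact transv_isometry B hB e he _ hsk
    have ht₀d : LinearMap.det t₀ = 1 := by rw [ht₀]; exact det_transv B hB e he _
    have hx₁ : t₀ x = x + (θ₀⁻¹ * B e x) • e := by rw [ht₀, transv_apply]
    have hfx₁ : B f (t₀ x) ≠ 0 := by
      have : B f (t₀ x) = -B e x := by
        rw [hx₁, map_add, map_smul, hfx, hfe, zero_add, smul_eq_mul]; field_simp
      rw [this]; exact neg_ne_zero.2 hex
    obtain ⟨t, hti, htψ, htd, p, htp⟩ := caseA (t₀ x) (by rw [ht₀i, hxx]) hfx₁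
    refine ⟨t * t₀, isometry_mul B _ _ hti ht₀i, ?_, ?_, p, by rw [Module.End.mul_apply, htp]⟩
    · rw [hψ _ _ hti ht₀i htd ht₀d, htψ, ht₀, psi_transv_e B ψ hψ hB hσ h2 he hf hef hθ hθ0 hα hα0 hα1 _ hsk,
        one_mul]
    · rw [map_mul, htd, ht₀d, one_mul]
  -- case C: `x ∈ {e, f}^⊥`
  by_cases hfx : B f x ≠ 0
  · exact caseA x hxx hfx
  by_cases hex : B e x ≠ 0
  · exact caseB x hxx (not_not.1 hfx) hex
  rw [not_not] at hfx hex
  obtain ⟨w₂, hw₂1, hw₂2, hw₂x⟩ : ∃ w₂ : V, B e w₂ = 0 ∧ B f w₂ = 0 ∧ B w₂ x ≠ 0 := by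
    by_contra hcon
    push Not at hcon
    exact hx0 (eq_zero_of_orth B hB hBnd he hf hef hθ hθ0 x hex hfx fun w hw1 hw2 =>
      apply_eq_zero_comm B hB (hcon w hw1 hw2))
  have h2σ : σ 2 = 2 := map_ofNat σ 2
  have hz₂ : -(B w₂ w₂) * 2⁻¹ + σ (-(B w₂ w₂) * 2⁻¹) + B w₂ w₂ = 0 := by
    rw [map_mul, map_neg, map_inv₀, h2σ, hB w₂ w₂]
    linear_combination (-(B w₂ w₂)) * inv_mul_cancel₀ h2
  obtain ⟨t₁, ht₁⟩ : ∃ t : Module.End K V,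
      t = (1 : Module.End K V) + (B f).smulRight w₂ + ((-(B w₂ w₂) * 2⁻¹) • B f - B w₂).smulRight f := ⟨_, rfl⟩
  have ht₁i : ∀ x y, B (t₁ x) (t₁ y) = B x y := by rw [ht₁]; exact root_isometry B hB f w₂ _ hf hw₂2 hz₂
  have ht₁d : LinearMap.det t₁ = 1 := by rw [ht₁]; exact det_root B hB f w₂ _ hf hw₂2
  have hx₂ : t₁ x = x - (B w₂ x) • f := by
    rw [ht₁, root_apply, hfx, zero_smul, add_zero, mul_zero, zero_sub, neg_smul, sub_eq_add_neg]
  have hfx₂ : B f (t₁ x) = 0 := by rw [hx₂, map_sub, map_smul, hfx, hf, smul_zero, sub_zero]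
  have hex₂ : B e (t₁ x) ≠ 0 := by
    rw [hx₂, map_sub, map_smul, hex, hef, zero_sub, smul_eq_mul]
    exact neg_ne_zero.2 (mul_ne_zero hw₂x hθ0)
  obtain ⟨t, hti, htψ, htd, p, htp⟩ := caseB (t₁ x) (by rw [ht₁i, hxx]) hfx₂ hex₂
  refine ⟨t * t₁, isometry_mul B _ _ hti ht₁i, ?_, ?_, p, by rw [Module.End.mul_apply, htp]⟩
  · rw [hψ _ _ hti ht₁i htd ht₁d, htψ, ht₁,
      psi_root_f B ψ hψ hB hσ h2 he hf hef hθ hθ0 hα hα0 hα1 w₂ hw₂1 hw₂2 _ hz₂, one_mul]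
  · rw [map_mul, htd, ht₁d, one_mul]

/-- **Reduction, step 2**: for an isometry `g` with `g e = p e` there is a root element on `e` (killed by `ψ`,
determinant `1`) with `T (g f) = (σp)⁻¹ f`; and `p ≠ 0`. [cite: Dieudonne1971GroupesClassiques, Chap. II §5] -/
theorem psi_exists_killed_apply_eq_f (g : Module.End K V) (hg : ∀ x y, B (g x) (g y) = B x y)
    (p : K) (hge : g e = p • e) :
    p ≠ 0 ∧ ∃ t : Module.End K V, (∀ x y, B (t x) (t y) = B x y) ∧ ψ t = 1 ∧ LinearMap.det t = 1 ∧ t e = e ∧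
      t (g f) = (σ p)⁻¹ • f := by
  obtain ⟨yW, hW1, hW2, hy⟩ := decomp_pair' B hB he hf hef hθ hθ0 (g f)
  have hegf : B e (g f) = θ₀ * (σ p)⁻¹ := by
    have h := hg e f
    rw [hge, apply_smul_left, hef] at h
    have hσp : σ p ≠ 0 := fun h0 => by rw [h0, zero_mul] at h; exact hθ0 h.symm
    rw [eq_mul_inv_iff_mul_eq₀ hσp, mul_comm]; exact h
  have hp : p ≠ 0 := by
    rintro rfl
    have h := hg e f
    rw [hge, zero_smul, map_zero, LinearMap.zero_apply, hef] at h
    exact hθ0 h.symm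
  have hσp : σ p ≠ 0 := fun h => hp (by simpa [hσ] using congrArg σ h)
  have hc : B e (g f) * θ₀⁻¹ ≠ 0 := mul_ne_zero (by rw [hegf]; exact mul_ne_zero hθ0 (inv_ne_zero hσp)) (inv_ne_zero hθ0)
  have hyy : B (yW + (B e (g f) * θ₀⁻¹) • f + (-(B f (g f) * θ₀⁻¹)) • e)
      (yW + (B e (g f) * θ₀⁻¹) • f + (-(B f (g f) * θ₀⁻¹)) • e) = 0 := by rw [← hy, hg, hf]
  obtain ⟨w, z, hw1, hw2, hz, hT⟩ := root_to_line B hB hσ he hf hef hθ hθ0 yW _ _ hc hW1 hW2 hyy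
  refine ⟨hp, _, root_isometry B hB e w z he hw1 hz,
    psi_root_e B ψ hψ hB hσ h2 he hf hef hθ hθ0 hα hα0 hα1 w hw1 hw2 z hz,
    det_root B hB e w z he hw1, root_apply_self B hB e w z he hw1, ?_⟩
  rw [hy, hT, hegf]
  congr 1
  field_simp

end Reduce

/-! ## §5 The rank-3 torus lemma: `D(p) Q(a, σp/p)` is a product of six root elements based at `e` and `f` -/

section Torus

variable (B : V →ₛₗ[σ] V →ₗ[K] K) (hB : ∀ x y, σ (B x y) = B y x) (hσ : ∀ x : K, σ (σ x) = x)
  {e f : V} {θ₀ : K} (he : B e e = 0) (hf : B f f = 0) (hef : B e f = θ₀) (hθ : σ θ₀ = -θ₀) (hθ0 : θ₀ ≠ 0)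
  {a : V} (ha1 : B e a = 0) (ha2 : B f a = 0) (ha : B a a ≠ 0)

include hB ha1 ha2 in
/-- **A root element `T(e, β a, z)` on the frame `(e, a, f)`**:
`T (x₁ e + x₂ a + x₃ f) = (x₁ + z θ₀ x₃ − B a a σβ x₂) e + (x₂ + θ₀ β x₃) a + x₃ f`. [folklore] -/
private theorem rootE_apply_comb (he : B e e = 0) (hef : B e f = θ₀) (β z x₁ x₂ x₃ : K) (y : V)
    (hy : y = x₁ • e + x₂ • a + x₃ • f) :
    ((1 : Module.End K V) + (B e).smulRight (β • a) + (z • B e - B (β • a)).smulRight e) y =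
      (x₁ + z * θ₀ * x₃ - B a a * σ β * x₂) • e + (x₂ + θ₀ * β * x₃) • a + x₃ • f := by
  subst hy
  have hae : B a e = 0 := apply_eq_zero_comm B hB ha1
  have haf : B a f = 0 := apply_eq_zero_comm B hB ha2
  rw [root_apply]
  simp only [map_add, map_smul, LinearMap.map_smulₛₗ, LinearMap.smul_apply, smul_eq_mul, he, ha1, hef, hae, haf,
    mul_zero, add_zero, zero_add, smul_smul]
  module

include hB ha1 ha2 in
/-- **A root element `T(f, γ a, x)` on the frame `(e, a, f)`**:
`T (x₁ e + x₂ a + x₃ f) = x₁ e + (x₂ − θ₀ γ x₁) a + (x₃ − x θ₀ x₁ − B a a σγ x₂) f`. [folklore] -/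
private theorem rootF_apply_comb (hf : B f f = 0) (hef : B e f = θ₀) (hθ : σ θ₀ = -θ₀) (γ x x₁ x₂ x₃ : K) (y : V)
    (hy : y = x₁ • e + x₂ • a + x₃ • f) :
    ((1 : Module.End K V) + (B f).smulRight (γ • a) + (x • B f - B (γ • a)).smulRight f) y =
      x₁ • e + (x₂ - θ₀ * γ * x₁) • a + (x₃ - x * θ₀ * x₁ - B a a * σ γ * x₂) • f := by
  subst hy
  have hae : B a e = 0 := apply_eq_zero_comm B hB ha1
  have haf : B a f = 0 := apply_eq_zero_comm B hB ha2
  have hfe : B f e = -θ₀ := apply_fe B hB hef hθ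
  rw [root_apply]
  simp only [map_add, map_smul, LinearMap.map_smulₛₗ, LinearMap.smul_apply, smul_eq_mul, hf, ha2, hfe, hae, haf,
    mul_zero, add_zero, smul_smul]
  module

/-- A root element `T(u, β a, z)` fixes every vector orthogonal to `u` and `a`. [folklore] -/
private theorem root_line_apply_of_orth (u : V) (β z : K) {y : V} (huy : B u y = 0) (hay : B a y = 0) :
    ((1 : Module.End K V) + (B u).smulRight (β • a) + (z • B u - B (β • a)).smulRight u) y = y :=
  root_apply_of_orth B u _ z huy (by rw [apply_smul_left, hay, mul_zero])

include hB he hf hef hθ hθ0 ha1 ha2 ha in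
/-- **Extensionality on the frame `(e, a, f)`**: two endomorphisms agreeing on `e`, `a`, `f` and on `{e, a, f}^⊥` are
equal. [folklore] -/
private theorem ext_of_triple (T₁ T₂ : Module.End K V) (h₁ : T₁ e = T₂ e) (h₂ : T₁ a = T₂ a) (h₃ : T₁ f = T₂ f)
    (h₄ : ∀ y, B e y = 0 → B f y = 0 → B a y = 0 → T₁ y = T₂ y) : T₁ = T₂ := by
  have hae : B a e = 0 := apply_eq_zero_comm B hB ha1
  have haf : B a f = 0 := apply_eq_zero_comm B hB ha2
  ext y
  obtain ⟨h1, h2⟩ := proj_orth B hB he hf hef hθ hθ0 y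
  have h1' : B e (y + (B f y * θ₀⁻¹) • e - (B e y * θ₀⁻¹) • f - (B a y * (B a a)⁻¹) • a) = 0 := by
    rw [map_sub (B e), h1, apply_smul_right, ha1, mul_zero, sub_zero]
  have h2' : B f (y + (B f y * θ₀⁻¹) • e - (B e y * θ₀⁻¹) • f - (B a y * (B a a)⁻¹) • a) = 0 := by
    rw [map_sub (B f), h2, apply_smul_right, ha2, mul_zero, sub_zero]
  have h3' : B a (y + (B f y * θ₀⁻¹) • e - (B e y * θ₀⁻¹) • f - (B a y * (B a a)⁻¹) • a) = 0 := by
    rw [map_sub, map_sub, map_add, apply_smul_right, apply_smul_right, apply_smul_right, hae, haf, mul_zero, mul_zero,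
      add_zero, sub_zero, inv_mul_cancel_right₀ ha, sub_self]
  have hw := h₄ _ h1' h2' h3'
  simp only [map_sub, map_add, map_smul, h₁, h₂, h₃] at hw
  calc T₁ y = (T₁ y + (B f y * θ₀⁻¹) • T₂ e - (B e y * θ₀⁻¹) • T₂ f - (B a y * (B a a)⁻¹) • T₂ a)
      - (B f y * θ₀⁻¹) • T₂ e + (B e y * θ₀⁻¹) • T₂ f + (B a y * (B a a)⁻¹) • T₂ a := by abel
    _ = (T₂ y + (B f y * θ₀⁻¹) • T₂ e - (B e y * θ₀⁻¹) • T₂ f - (B a y * (B a a)⁻¹) • T₂ a)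
      - (B f y * θ₀⁻¹) • T₂ e + (B e y * θ₀⁻¹) • T₂ f + (B a y * (B a a)⁻¹) • T₂ a := by rw [hw]
    _ = T₂ y := by abel

/-! ### The monomial element `P(γ, x) = T(e, b₁ a, ζ) T(f, γ a, x) T(e, b₂ a, ζ)` -/

section Monomial

variable (γ x b₁ b₂ ζ : K) (hx : x + σ x + σ γ * (γ * B a a) = 0) (hx0 : x ≠ 0)
  (hb₁ : b₁ = -(γ * (x * θ₀)⁻¹)) (hb₂ : b₂ = -(γ * (σ x * θ₀)⁻¹)) (hζ : ζ = -(σ x * (θ₀ * θ₀))⁻¹)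

include hσ hθ hx hx0 hb₁ hζ in
/-- Admissibility of the first root element of `P(γ, x)`. [folklore] -/
private theorem monomial_adm₁ : ζ + σ ζ + B (b₁ • a) (b₁ • a) = 0 := by
  have hσx0 : σ x ≠ 0 := fun h => hx0 (by simpa [hσ] using congrArg σ h)
  obtain ⟨d, hd⟩ : ∃ d, σ x = d := ⟨_, rfl⟩
  have hd0 : d ≠ 0 := hd ▸ hσx0
  have hrel : d = -x - σ γ * (γ * B a a) := by rw [← hd]; linear_combination hx
  rw [apply_smul_left, apply_smul_right, hζ, hb₁]
  simp only [map_neg, map_mul, map_inv₀, hσ, hθ]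
  rw [hd]
  field_simp
  rw [hrel]
  ring

include hσ hθ hx hx0 hb₂ hζ in
/-- Admissibility of the third root element of `P(γ, x)`. [folklore] -/
private theorem monomial_adm₂ : ζ + σ ζ + B (b₂ • a) (b₂ • a) = 0 := by
  have hσx0 : σ x ≠ 0 := fun h => hx0 (by simpa [hσ] using congrArg σ h)
  obtain ⟨d, hd⟩ : ∃ d, σ x = d := ⟨_, rfl⟩
  have hd0 : d ≠ 0 := hd ▸ hσx0
  have hrel : d = -x - σ γ * (γ * B a a) := by rw [← hd]; linear_combination hx
  rw [apply_smul_left, apply_smul_right, hζ, hb₂]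
  simp only [map_neg, map_mul, map_inv₀, hσ, hθ]
  rw [hd]
  field_simp
  rw [hrel]
  ring

include hx in
/-- Admissibility of the middle root element of `P(γ, x)`. [folklore] -/
private theorem monomial_adm : x + σ x + B (γ • a) (γ • a) = 0 := by
  rw [apply_smul_left, apply_smul_right]; exact hx

include hB hσ he hf hef hθ hθ0 ha1 ha2 hx hx0 hb₁ hζ in
/-- **`P(γ, x) e = (−x θ₀) f`.** [cite: Dieudonne1971GroupesClassiques, Chap. II §5] -/
private theorem monomial_apply_e :
    (((1 : Module.End K V) + (B e).smulRight (b₁ • a) + (ζ • B e - B (b₁ • a)).smulRight e) *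
      ((1 : Module.End K V) + (B f).smulRight (γ • a) + (x • B f - B (γ • a)).smulRight f) *
      ((1 : Module.End K V) + (B e).smulRight (b₂ • a) + (ζ • B e - B (b₂ • a)).smulRight e)) e =
      (-(x * θ₀)) • f := by
  have hσx0 : σ x ≠ 0 := fun h => hx0 (by simpa [hσ] using congrArg σ h)
  obtain ⟨d, hd⟩ : ∃ d, σ x = d := ⟨_, rfl⟩
  have hd0 : d ≠ 0 := hd ▸ hσx0
  have hrel : d = -x - σ γ * (γ * B a a) := by rw [← hd]; linear_combination hx
  rw [Module.End.mul_apply, Module.End.mul_apply,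
    root_apply_self B hB e _ ζ he (by rw [map_smul, ha1, smul_zero]),
    rootF_apply_comb B hB ha1 ha2 hf hef hθ γ x 1 0 0 e (by module),
    rootE_apply_comb B hB ha1 ha2 he hef b₁ ζ _ _ _ _ rfl, hb₁, hζ]
  simp only [map_neg, map_mul, map_inv₀, hθ]
  rw [hd]
  match_scalars <;> (field_simp; (try rw [hrel]); ring)

include hB hσ he hf hef hθ hθ0 ha1 ha2 hx hx0 hb₁ hb₂ hζ in
/-- **`P(γ, x) f = −(σx θ₀)⁻¹ e`.** [cite: Dieudonne1971GroupesClassiques, Chap. II §5] -/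
private theorem monomial_apply_f :
    (((1 : Module.End K V) + (B e).smulRight (b₁ • a) + (ζ • B e - B (b₁ • a)).smulRight e) *
      ((1 : Module.End K V) + (B f).smulRight (γ • a) + (x • B f - B (γ • a)).smulRight f) *
      ((1 : Module.End K V) + (B e).smulRight (b₂ • a) + (ζ • B e - B (b₂ • a)).smulRight e)) f =
      (-(σ x * θ₀)⁻¹) • e := by
  have hσx0 : σ x ≠ 0 := fun h => hx0 (by simpa [hσ] using congrArg σ h)
  obtain ⟨d, hd⟩ : ∃ d, σ x = d := ⟨_, rfl⟩
  have hd0 : d ≠ 0 := hd ▸ hσx0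
  have hrel : d = -x - σ γ * (γ * B a a) := by rw [← hd]; linear_combination hx
  rw [Module.End.mul_apply, Module.End.mul_apply,
    rootE_apply_comb B hB ha1 ha2 he hef b₂ ζ 0 0 1 f (by module),
    rootF_apply_comb B hB ha1 ha2 hf hef hθ γ x _ _ _ _ rfl,
    rootE_apply_comb B hB ha1 ha2 he hef b₁ ζ _ _ _ _ rfl, hb₁, hb₂, hζ]
  simp only [map_neg, map_mul, map_inv₀, hσ, hθ]
  rw [hd]
  match_scalars <;> (field_simp; (try rw [hrel]); ring)

include hB hσ he hf hef hθ hθ0 ha1 ha2 hx hx0 hb₁ hb₂ hζ in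
/-- **`P(γ, x) a = −(σx/x) a`.** [cite: Dieudonne1971GroupesClassiques, Chap. II §5] -/
private theorem monomial_apply_a :
    (((1 : Module.End K V) + (B e).smulRight (b₁ • a) + (ζ • B e - B (b₁ • a)).smulRight e) *
      ((1 : Module.End K V) + (B f).smulRight (γ • a) + (x • B f - B (γ • a)).smulRight f) *
      ((1 : Module.End K V) + (B e).smulRight (b₂ • a) + (ζ • B e - B (b₂ • a)).smulRight e)) a =
      (-(σ x * x⁻¹)) • a := by
  have hσx0 : σ x ≠ 0 := fun h => hx0 (by simpa [hσ] using congrArg σ h)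
  obtain ⟨d, hd⟩ : ∃ d, σ x = d := ⟨_, rfl⟩
  have hd0 : d ≠ 0 := hd ▸ hσx0
  have hrel : d = -x - σ γ * (γ * B a a) := by rw [← hd]; linear_combination hx
  rw [Module.End.mul_apply, Module.End.mul_apply,
    rootE_apply_comb B hB ha1 ha2 he hef b₂ ζ 0 1 0 a (by module),
    rootF_apply_comb B hB ha1 ha2 hf hef hθ γ x _ _ _ _ rfl,
    rootE_apply_comb B hB ha1 ha2 he hef b₁ ζ _ _ _ _ rfl, hb₁, hb₂, hζ]
  simp only [map_neg, map_mul, map_inv₀, hσ, hθ]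
  rw [hd]
  match_scalars <;> (field_simp; (try rw [hrel]); ring)

/-- `P(γ, x)` fixes `{e, a, f}^⊥` pointwise. [folklore] -/
private theorem monomial_apply_of_orth (y : V) (hy1 : B e y = 0) (hy2 : B f y = 0) (hy3 : B a y = 0) :
    (((1 : Module.End K V) + (B e).smulRight (b₁ • a) + (ζ • B e - B (b₁ • a)).smulRight e) *
      ((1 : Module.End K V) + (B f).smulRight (γ • a) + (x • B f - B (γ • a)).smulRight f) *
      ((1 : Module.End K V) + (B e).smulRight (b₂ • a) + (ζ • B e - B (b₂ • a)).smulRight e)) y = y := by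
  rw [Module.End.mul_apply, Module.End.mul_apply, root_line_apply_of_orth B e b₂ ζ hy1 hy3,
    root_line_apply_of_orth B f γ x hy2 hy3, root_line_apply_of_orth B e b₁ ζ hy1 hy3]

include hB hσ he hf hθ ha1 ha2 hx hx0 hb₁ hb₂ hζ in
/-- `P(γ, x)` is an isometry. [folklore] -/
private theorem monomial_isometry (y y' : V) :
    B ((((1 : Module.End K V) + (B e).smulRight (b₁ • a) + (ζ • B e - B (b₁ • a)).smulRight e) *
      ((1 : Module.End K V) + (B f).smulRight (γ • a) + (x • B f - B (γ • a)).smulRight f) *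
      ((1 : Module.End K V) + (B e).smulRight (b₂ • a) + (ζ • B e - B (b₂ • a)).smulRight e)) y)
      ((((1 : Module.End K V) + (B e).smulRight (b₁ • a) + (ζ • B e - B (b₁ • a)).smulRight e) *
      ((1 : Module.End K V) + (B f).smulRight (γ • a) + (x • B f - B (γ • a)).smulRight f) *
      ((1 : Module.End K V) + (B e).smulRight (b₂ • a) + (ζ • B e - B (b₂ • a)).smulRight e)) y') = B y y' :=
  isometry_mul B _ _ (isometry_mul B _ _
    (root_isometry B hB e _ ζ he (by rw [map_smul, ha1, smul_zero])
      (monomial_adm₁ B hσ hθ γ x b₁ ζ hx hx0 hb₁ hζ))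
    (root_isometry B hB f _ x hf (by rw [map_smul, ha2, smul_zero]) (monomial_adm B γ x hx)))
    (root_isometry B hB e _ ζ he (by rw [map_smul, ha1, smul_zero]) (monomial_adm₂ B hσ hθ γ x b₂ ζ hx hx0 hb₂ hζ))
    y y'

include hB he hf ha1 ha2 in
/-- `det P(γ, x) = 1`. [folklore] -/
private theorem monomial_det [FiniteDimensional K V] :
    LinearMap.det (((1 : Module.End K V) + (B e).smulRight (b₁ • a) + (ζ • B e - B (b₁ • a)).smulRight e) *
      ((1 : Module.End K V) + (B f).smulRight (γ • a) + (x • B f - B (γ • a)).smulRight f) *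
      ((1 : Module.End K V) + (B e).smulRight (b₂ • a) + (ζ • B e - B (b₂ • a)).smulRight e)) = 1 := by
  rw [map_mul, map_mul, det_root B hB e _ ζ he (by rw [map_smul, ha1, smul_zero]),
    det_root B hB f _ x hf (by rw [map_smul, ha2, smul_zero]), det_root B hB e _ ζ he (by rw [map_smul, ha1, smul_zero]),
    one_mul, one_mul]

section MonomialPsi

variable [FiniteDimensional K V] {A : Type*} [CommGroup A] (ψ : Module.End K V → A)
  (hψ : ∀ g h : Module.End K V, (∀ x y, B (g x) (g y) = B x y) → (∀ x y, B (h x) (h y) = B x y) →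
    LinearMap.det g = 1 → LinearMap.det h = 1 → ψ (g * h) = ψ g * ψ h)
  (h2 : (2 : K) ≠ 0) {α : K} (hα : σ α = α) (hα0 : α ≠ 0) (hα1 : α * α ≠ 1)

include hψ hB hσ h2 he hf hef hθ hθ0 hα hα0 hα1 ha1 ha2 hx hx0 hb₁ hb₂ hζ in
/-- **`ψ` kills the monomial element `P(γ, x)`** — it is a product of three root elements based at `e` and `f`.
[cite: Dieudonne1971GroupesClassiques, Chap. II §5] -/
private theorem psi_monomial :
    ψ (((1 : Module.End K V) + (B e).smulRight (b₁ • a) + (ζ • B e - B (b₁ • a)).smulRight e) *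
      ((1 : Module.End K V) + (B f).smulRight (γ • a) + (x • B f - B (γ • a)).smulRight f) *
      ((1 : Module.End K V) + (B e).smulRight (b₂ • a) + (ζ • B e - B (b₂ • a)).smulRight e)) = 1 := by
  have h1a : B e (b₁ • a) = 0 := by rw [map_smul, ha1, smul_zero]
  have h2a : B e (b₂ • a) = 0 := by rw [map_smul, ha1, smul_zero]
  have hγa : B f (γ • a) = 0 := by rw [map_smul, ha2, smul_zero]
  have hadm₁ := monomial_adm₁ B hσ hθ γ x b₁ ζ hx hx0 hb₁ hζ
  have hadm₂ := monomial_adm₂ B hσ hθ γ x b₂ ζ hx hx0 hb₂ hζ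
  have hadm := monomial_adm B γ x hx
  rw [psi_mul_three B ψ hψ _ _ _ (root_isometry B hB e _ ζ he h1a hadm₁) (root_isometry B hB f _ x hf hγa hadm)
    (root_isometry B hB e _ ζ he h2a hadm₂) (det_root B hB e _ ζ he h1a) (det_root B hB f _ x hf hγa)
    (det_root B hB e _ ζ he h2a),
    psi_root_e B ψ hψ hB hσ h2 he hf hef hθ hθ0 hα hα0 hα1 _ h1a (by rw [map_smul, ha2, smul_zero]) ζ hadm₁,
    psi_root_f B ψ hψ hB hσ h2 he hf hef hθ hθ0 hα hα0 hα1 _ (by rw [map_smul, ha1, smul_zero]) hγa x hadm,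
    psi_root_e B ψ hψ hB hσ h2 he hf hef hθ hθ0 hα hα0 hα1 _ h2a (by rw [map_smul, ha2, smul_zero]) ζ hadm₂,
    one_mul, one_mul]

end MonomialPsi

end Monomial

/-! ### The torus identity -/

include hB hσ ha in
/-- The parameters of the two monomial elements factoring `D(p) Q(a, σp/p)` (`σp ≠ p`): `x₂ = B a a (p − σp)⁻¹` is skew
and non-zero, `x₁ = −p x₂` satisfies `x₁ + σx₁ + B a a = 0`, `σ x₁ = σp · x₂`. [folklore] -/
private theorem torus_params (p x₁ x₂ : K) (hp0 : p ≠ 0) (hp : σ p ≠ p) (hx₂ : x₂ = B a a * (p - σ p)⁻¹)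
    (hx₁ : x₁ = -(p * x₂)) :
    σ x₂ = -x₂ ∧ x₂ ≠ 0 ∧ σ x₁ = σ p * x₂ ∧ x₁ ≠ 0 ∧ (x₂ + σ x₂ + σ 0 * (0 * B a a) = 0) ∧
      (x₁ + σ x₁ + σ 1 * (1 * B a a) = 0) := by
  have hps : p - σ p ≠ 0 := sub_ne_zero.2 (Ne.symm hp)
  have hσx₂ : σ x₂ = -x₂ := by
    rw [hx₂, map_mul, map_inv₀, map_sub, hσ, hB a a, ← neg_sub p (σ p), inv_neg, mul_neg]
  have hx₂0 : x₂ ≠ 0 := by rw [hx₂]; exact mul_ne_zero ha (inv_ne_zero hps)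
  have hσx₁ : σ x₁ = σ p * x₂ := by rw [hx₁, map_neg, map_mul, hσx₂, mul_neg, neg_neg]
  have hx₁0 : x₁ ≠ 0 := by rw [hx₁]; exact neg_ne_zero.2 (mul_ne_zero hp0 hx₂0)
  refine ⟨hσx₂, hx₂0, hσx₁, hx₁0, ?_, ?_⟩
  · rw [hσx₂, map_zero, zero_mul, add_zero, add_neg_cancel]
  · rw [hσx₁, hx₁, map_one, one_mul, one_mul, hx₂]
    field_simp
    ring

include hB hσ he hf hef hθ hθ0 ha1 ha2 ha in
/-- **The torus identity** [cite: Dieudonne1971GroupesClassiques, Chap. II §5]: for `σp ≠ p`,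
`D(p) · Q(a, σp p⁻¹) = P(0, x₂) · P(1, x₁)` with `x₂ = B a a (p − σp)⁻¹`, `x₁ = −p x₂` — an element of the rank-3 torus of
`SU(K e ⊕ K a ⊕ K f)` written as a product of six root elements based at `e` and `f`. -/
private theorem dil_mul_quasi_eq (p x₁ x₂ b₁ b₂ ζ₁ c₁ c₂ ζ₂ : K) (hp0 : p ≠ 0) (hp : σ p ≠ p)
    (hx₂ : x₂ = B a a * (p - σ p)⁻¹) (hx₁ : x₁ = -(p * x₂))
    (hb₁ : b₁ = -(1 * (x₁ * θ₀)⁻¹)) (hb₂ : b₂ = -(1 * (σ x₁ * θ₀)⁻¹)) (hζ₁ : ζ₁ = -(σ x₁ * (θ₀ * θ₀))⁻¹)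
    (hc₁ : c₁ = -(0 * (x₂ * θ₀)⁻¹)) (hc₂ : c₂ = -(0 * (σ x₂ * θ₀)⁻¹)) (hζ₂ : ζ₂ = -(σ x₂ * (θ₀ * θ₀))⁻¹) :
    ((1 : Module.End K V) + ((1 - p) * θ₀⁻¹) • (B f).smulRight e + (((σ p)⁻¹ - 1) * θ₀⁻¹) • (B e).smulRight f) *
        ((1 : Module.End K V) + ((σ p * p⁻¹ - 1) * (B a a)⁻¹) • (B a).smulRight a) =
      (((1 : Module.End K V) + (B e).smulRight (c₁ • a) + (ζ₂ • B e - B (c₁ • a)).smulRight e) *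
        ((1 : Module.End K V) + (B f).smulRight ((0 : K) • a) + (x₂ • B f - B ((0 : K) • a)).smulRight f) *
        ((1 : Module.End K V) + (B e).smulRight (c₂ • a) + (ζ₂ • B e - B (c₂ • a)).smulRight e)) *
      (((1 : Module.End K V) + (B e).smulRight (b₁ • a) + (ζ₁ • B e - B (b₁ • a)).smulRight e) *
        ((1 : Module.End K V) + (B f).smulRight ((1 : K) • a) + (x₁ • B f - B ((1 : K) • a)).smulRight f) *
        ((1 : Module.End K V) + (B e).smulRight (b₂ • a) + (ζ₁ • B e - B (b₂ • a)).smulRight e)) := by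
  obtain ⟨hσx₂, hx₂0, hσx₁, hx₁0, hadm₂, hadm₁⟩ := torus_params B hB hσ ha p x₁ x₂ hp0 hp hx₂ hx₁
  have hσp0 : σ p ≠ 0 := fun h => hp0 (by simpa [hσ] using congrArg σ h)
  have hae : B a e = 0 := apply_eq_zero_comm B hB ha1
  have haf : B a f = 0 := apply_eq_zero_comm B hB ha2
  refine ext_of_triple B hB he hf hef hθ hθ0 ha1 ha2 ha _ _ ?_ ?_ ?_ ?_
  · rw [Module.End.mul_apply, quasi_apply_of_orth B a _ hae, dil_apply_e B hB he hef hθ hθ0, Module.End.mul_apply,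
      monomial_apply_e B hB hσ he hf hef hθ hθ0 ha1 ha2 1 x₁ b₁ b₂ ζ₁ hadm₁ hx₁0 hb₁ hζ₁, map_smul,
      monomial_apply_f B hB hσ he hf hef hθ hθ0 ha1 ha2 0 x₂ c₁ c₂ ζ₂ hadm₂ hx₂0 hc₁ hc₂ hζ₂, smul_smul, hσx₂, hx₁]
    congr 1
    field_simp
  · rw [Module.End.mul_apply, quasi_apply_self B a ha, map_smul, dil_apply_of_orth B e f θ₀ p ha1 ha2,
      Module.End.mul_apply, monomial_apply_a B hB hσ he hf hef hθ hθ0 ha1 ha2 1 x₁ b₁ b₂ ζ₁ hadm₁ hx₁0 hb₁ hb₂ hζ₁,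
      map_smul, monomial_apply_a B hB hσ he hf hef hθ hθ0 ha1 ha2 0 x₂ c₁ c₂ ζ₂ hadm₂ hx₂0 hc₁ hc₂ hζ₂, smul_smul,
      hσx₂, hσx₁, hx₁]
    congr 1
    field_simp
  · rw [Module.End.mul_apply, quasi_apply_of_orth B a _ haf, dil_apply_f B hf hef hθ0, Module.End.mul_apply,
      monomial_apply_f B hB hσ he hf hef hθ hθ0 ha1 ha2 1 x₁ b₁ b₂ ζ₁ hadm₁ hx₁0 hb₁ hb₂ hζ₁, map_smul,
      monomial_apply_e B hB hσ he hf hef hθ hθ0 ha1 ha2 0 x₂ c₁ c₂ ζ₂ hadm₂ hx₂0 hc₁ hζ₂, smul_smul, hσx₁]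
    congr 1
    field_simp
  · intro y hy1 hy2 hy3
    rw [Module.End.mul_apply, quasi_apply_of_orth B a _ hy3, dil_apply_of_orth B e f θ₀ p hy1 hy2,
      Module.End.mul_apply, monomial_apply_of_orth B 1 x₁ b₁ b₂ ζ₁ y hy1 hy2 hy3,
      monomial_apply_of_orth B 0 x₂ c₁ c₂ ζ₂ y hy1 hy2 hy3]

section TorusPsi

variable [FiniteDimensional K V] {A : Type*} [CommGroup A] (ψ : Module.End K V → A)
  (hψ : ∀ g h : Module.End K V, (∀ x y, B (g x) (g y) = B x y) → (∀ x y, B (h x) (h y) = B x y) →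
    LinearMap.det g = 1 → LinearMap.det h = 1 → ψ (g * h) = ψ g * ψ h)
  (h2 : (2 : K) ≠ 0) {α : K} (hα : σ α = α) (hα0 : α ≠ 0) (hα1 : α * α ≠ 1)

include hψ hB hσ h2 he hf hef hθ hθ0 hα hα0 hα1 ha1 ha2 ha in
/-- **The torus lemma: `ψ (D(p) · Q(a, σp/p)) = 1` for every `p ≠ 0`** (`a` anisotropic, `a ⊥ e, f`).  For `σp = p`
this is the `SL₂(K^σ)` identity (`Q(a, 1) = 1`); otherwise `D(p) Q(a, σp/p)` is the product of the two monomial elements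
`P(0, x₂)`, `P(1, x₁)`, each a product of three root elements based at `e`, `f`, all of determinant `1` and all killed.
[cite: Dieudonne1971GroupesClassiques, Chap. II §5] -/
theorem psi_dil_mul_quasi (p : K) (hp0 : p ≠ 0) :
    ψ (((1 : Module.End K V) + ((1 - p) * θ₀⁻¹) • (B f).smulRight e + (((σ p)⁻¹ - 1) * θ₀⁻¹) • (B e).smulRight f) *
        ((1 : Module.End K V) + ((σ p * p⁻¹ - 1) * (B a a)⁻¹) • (B a).smulRight a)) = 1 := by
  by_cases hp : σ p = p
  · have h1 : σ p * p⁻¹ = 1 := by rw [hp, mul_inv_cancel₀ hp0]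
    rw [h1, quasi_one, mul_one]
    exact psi_dil_of_fixed B ψ hψ hB hσ h2 he hf hef hθ hθ0 hα hα0 hα1 p hp hp0
  · rw [dil_mul_quasi_eq B hB hσ he hf hef hθ hθ0 ha1 ha2 ha p _ _ _ _ _ _ _ _ hp0 hp rfl rfl rfl rfl rfl rfl rfl rfl]
    obtain ⟨-, hx₂0, -, hx₁0, hadm₂, hadm₁⟩ := torus_params B hB hσ ha p _ _ hp0 hp rfl rfl
    rw [hψ _ _ (monomial_isometry B hB hσ he hf hθ ha1 ha2 0 _ _ _ _ hadm₂ hx₂0 rfl rfl rfl)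
      (monomial_isometry B hB hσ he hf hθ ha1 ha2 1 _ _ _ _ hadm₁ hx₁0 rfl rfl rfl)
      (monomial_det B hB he hf ha1 ha2 0 _ _ _ _) (monomial_det B hB he hf ha1 ha2 1 _ _ _ _),
      psi_monomial B hB hσ he hf hef hθ hθ0 ha1 ha2 0 _ _ _ _ hadm₂ hx₂0 rfl rfl rfl ψ hψ h2 hα hα0 hα1,
      psi_monomial B hB hσ he hf hef hθ hθ0 ha1 ha2 1 _ _ _ _ hadm₁ hx₁0 rfl rfl rfl ψ hψ h2 hα hα0 hα1, one_mul]

end TorusPsi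

end Torus

/-! ## §6 Complementary submodules (the engine's §8), anisotropic vectors, Hilbert 90 -/

/-- Two endomorphisms agreeing on complementary submodules are equal. [folklore] -/
private theorem eq_of_isCompl (W W' : Submodule K V) (hc : IsCompl W W') (T₁ T₂ : Module.End K V)
    (h₁ : ∀ w ∈ W, T₁ w = T₂ w) (h₂ : ∀ y ∈ W', T₁ y = T₂ y) : T₁ = T₂ := by
  ext x
  have hx : x ∈ W ⊔ W' := by rw [hc.sup_eq_top]; exact Submodule.mem_top
  obtain ⟨w, hw, y, hy, rfl⟩ := Submodule.mem_sup.1 hx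
  rw [map_add, map_add, h₁ w hw, h₂ y hy]

/-- **Extension by the identity**: for complementary `W, W'` there is a monoid homomorphism
`ι : End W →* End V` with `ι h = h` on `W`, `ι h = id` on `W'`, and `det (ι h) = det h`. [folklore] -/
private theorem exists_extension [FiniteDimensional K V] (W W' : Submodule K V) (hc : IsCompl W W') :
    ∃ ι : Module.End K W →* Module.End K V,
      (∀ (h : Module.End K W) (w : W), ι h (w : V) = (h w : V)) ∧
      (∀ (h : Module.End K W) (y : V), y ∈ W' → ι h y = y) ∧
      ∀ h : Module.End K W, LinearMap.det (ι h) = LinearMap.det h := by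
  let E := Submodule.prodEquivOfIsCompl W W' hc
  have hval : ∀ (h : Module.End K W) (x : V),
      E.conj (h.prodMap (1 : Module.End K W')) x = E ((h.prodMap (1 : Module.End K W')) (E.symm x)) := by
    intro h x; rw [LinearEquiv.conj_apply]; rfl
  refine ⟨{ toFun := fun h => E.conj (h.prodMap (1 : Module.End K W'))
            map_one' := ?_
            map_mul' := ?_ }, ?_, ?_, ?_⟩
  · ext x
    rw [hval, LinearMap.prodMap_apply, Module.End.one_apply, Module.End.one_apply, Prod.mk.eta,
      LinearEquiv.apply_symm_apply, Module.End.one_apply]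
  · intro h h'
    ext x
    simp only [Module.End.mul_apply, hval, LinearEquiv.symm_apply_apply]
    rfl
  · intro h w
    simp only [MonoidHom.coe_mk, OneHom.coe_mk, hval, Submodule.prodEquivOfIsCompl_symm_apply_left,
      LinearMap.prodMap_apply, Submodule.coe_prodEquivOfIsCompl', map_zero, Submodule.coe_zero, add_zero, E]
  · intro h y hy
    have := Submodule.prodEquivOfIsCompl_symm_apply_right W W' hc ⟨y, hy⟩
    simp only [MonoidHom.coe_mk, OneHom.coe_mk, hval, E]
    rw [show (y : V) = ((⟨y, hy⟩ : W') : V) from rfl, this, LinearMap.prodMap_apply, map_zero,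
      Submodule.coe_prodEquivOfIsCompl', Submodule.coe_zero, zero_add, Module.End.one_apply]
  · intro h
    simp only [MonoidHom.coe_mk, OneHom.coe_mk]
    rw [LinearEquiv.conj_apply, LinearMap.comp_assoc, LinearMap.det_conj, LinearMap.det_prodMap, map_one, mul_one]

/-- **Extensions of isometries are isometries** when `W ⊥ W'`. [folklore] -/
private theorem extension_isometry (B : V →ₛₗ[σ] V →ₗ[K] K) (hB : ∀ x y, σ (B x y) = B y x) (W W' : Submodule K V)
    (hc : IsCompl W W') (horth : ∀ w ∈ W, ∀ y ∈ W', B w y = 0) (ι : Module.End K W →* Module.End K V)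
    (hι₁ : ∀ (h : Module.End K W) (w : W), ι h (w : V) = (h w : V))
    (hι₂ : ∀ (h : Module.End K W) (y : V), y ∈ W' → ι h y = y) (h : Module.End K W)
    (hh : ∀ x y : W, B ((h x : W) : V) ((h y : W) : V) = B (x : V) (y : V)) (x y : V) :
    B (ι h x) (ι h y) = B x y := by
  have hx : x ∈ W ⊔ W' := by rw [hc.sup_eq_top]; exact Submodule.mem_top
  have hy : y ∈ W ⊔ W' := by rw [hc.sup_eq_top]; exact Submodule.mem_top
  obtain ⟨w, hw, x', hx', rfl⟩ := Submodule.mem_sup.1 hx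
  obtain ⟨v, hv, y', hy', rfl⟩ := Submodule.mem_sup.1 hy
  have horth' : ∀ y ∈ W', ∀ w ∈ W, B y w = 0 := fun y hy w hw => apply_eq_zero_comm B hB (horth w hw y hy)
  have e1 : ι h (w + x') = ((h ⟨w, hw⟩ : W) : V) + x' := by rw [map_add, hι₂ h x' hx', ← hι₁ h ⟨w, hw⟩]
  have e2 : ι h (v + y') = ((h ⟨v, hv⟩ : W) : V) + y' := by rw [map_add, hι₂ h y' hy', ← hι₁ h ⟨v, hv⟩]
  have o1 : B ((h ⟨w, hw⟩ : W) : V) y' = 0 := horth _ (h _).2 _ hy'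
  have o2 : B x' ((h ⟨v, hv⟩ : W) : V) = 0 := horth' _ hx' _ (h _).2
  have o3 : B w y' = 0 := horth _ hw _ hy'
  have o4 : B x' v = 0 := horth' _ hx' _ hv
  have hh' := hh ⟨w, hw⟩ ⟨v, hv⟩
  rw [e1, e2, apply_add_left, apply_add_left, map_add, map_add, map_add, map_add, hh', o1, o2, o3, o4]

/-- The complement `{e, f}^⊥ = ker (B e) ⊓ ker (B f)` and the plane `span {e, f}` are complementary. [folklore] -/
private theorem isCompl_pair (B : V →ₛₗ[σ] V →ₗ[K] K) (hB : ∀ x y, σ (B x y) = B y x) {e f : V} {θ₀ : K}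
    (he : B e e = 0) (hf : B f f = 0) (hef : B e f = θ₀) (hθ : σ θ₀ = -θ₀) (hθ0 : θ₀ ≠ 0) :
    IsCompl (LinearMap.ker (B e) ⊓ LinearMap.ker (B f)) (Submodule.span K {e, f}) := by
  have hfe := apply_fe B hB hef hθ
  refine isCompl_iff.2 ⟨?_, ?_⟩
  · rw [Submodule.disjoint_def]
    intro x hx hx'
    obtain ⟨a, b, rfl⟩ := Submodule.mem_span_pair.1 hx'
    obtain ⟨h1, h2⟩ := Submodule.mem_inf.1 hx
    rw [LinearMap.mem_ker, map_add, map_smul, map_smul, he, hef, smul_zero, zero_add, smul_eq_mul] at h1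
    rw [LinearMap.mem_ker, map_add, map_smul, map_smul, hf, hfe, smul_zero, add_zero, smul_eq_mul, mul_neg,
      neg_eq_zero] at h2
    rw [(mul_eq_zero.1 h1).resolve_right hθ0, (mul_eq_zero.1 h2).resolve_right hθ0, zero_smul, zero_smul, add_zero]
  · rw [codisjoint_iff, Submodule.eq_top_iff']
    intro y
    obtain ⟨h1, h2⟩ := proj_orth B hB he hf hef hθ hθ0 y
    have : y = (y + (B f y * θ₀⁻¹) • e - (B e y * θ₀⁻¹) • f) + ((-(B f y * θ₀⁻¹)) • e + (B e y * θ₀⁻¹) • f) := by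
      rw [neg_smul]; abel
    rw [this]
    exact Submodule.add_mem_sup (Submodule.mem_inf.2 ⟨h1, h2⟩) (Submodule.mem_span_pair.2 ⟨_, _, rfl⟩)

/-- `{e, f}^⊥ ⊥ span {e, f}`. [folklore] -/
private theorem orth_pair (B : V →ₛₗ[σ] V →ₗ[K] K) (hB : ∀ x y, σ (B x y) = B y x) (e f : V)
    (w : V) (hw : w ∈ LinearMap.ker (B e) ⊓ LinearMap.ker (B f)) (y : V) (hy : y ∈ Submodule.span K {e, f}) :
    B w y = 0 := by
  obtain ⟨a, b, rfl⟩ := Submodule.mem_span_pair.1 hy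
  obtain ⟨h1, h2⟩ := Submodule.mem_inf.1 hw
  rw [LinearMap.mem_ker] at h1 h2
  rw [map_add, map_smul, map_smul, apply_eq_zero_comm B hB h1, apply_eq_zero_comm B hB h2, smul_zero, smul_zero,
    add_zero]

/-- The extension of a quasi-symmetry of `W` is the quasi-symmetry of `V` (`W ⊥ W'`). [folklore] -/
private theorem extension_quasi (B : V →ₛₗ[σ] V →ₗ[K] K) (W W' : Submodule K V)
    (hc : IsCompl W W') (horth : ∀ w ∈ W, ∀ y ∈ W', B w y = 0) (ι : Module.End K W →* Module.End K V)
    (hι₁ : ∀ (h : Module.End K W) (w : W), ι h (w : V) = (h w : V))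
    (hι₂ : ∀ (h : Module.End K W) (y : V), y ∈ W' → ι h y = y) (a : W) (μ : K) :
    ι ((1 : Module.End K W) + ((μ - 1) * (B.domRestrict₁₂ W W a a)⁻¹) • (B.domRestrict₁₂ W W a).smulRight a) =
      (1 : Module.End K V) + ((μ - 1) * (B (a : V) (a : V))⁻¹) • (B (a : V)).smulRight (a : V) := by
  refine eq_of_isCompl W W' hc _ _ (fun w hw => ?_) (fun y hy => ?_)
  · rw [show w = ((⟨w, hw⟩ : W) : V) from rfl, hι₁, quasi_apply, quasi_apply]
    simp only [LinearMap.domRestrict₁₂_apply, Submodule.coe_add, Submodule.coe_smul]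
  · rw [hι₂ _ y hy, quasi_apply_of_orth B _ _ (horth _ a.2 _ hy)]

/-- A non-zero non-degenerate hermitian space (involution `σ ≠ 1`, `2 ≠ 0`) has an anisotropic vector. [folklore] -/
private theorem exists_anisotropic (B : V →ₛₗ[σ] V →ₗ[K] K) (hB : ∀ x y, σ (B x y) = B y x)
    (hBnd : ∀ x, (∀ y, B x y = 0) → x = 0) {θ₀ : K} (hθ : σ θ₀ = -θ₀) (hθ0 : θ₀ ≠ 0) (h2 : (2 : K) ≠ 0)
    (hne : ∃ w : V, w ≠ 0) : ∃ a : V, B a a ≠ 0 := by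
  by_contra hall
  push Not at hall
  obtain ⟨w, hw⟩ := hne
  refine hw (hBnd w fun y => ?_)
  have h1 := hall (w + y)
  have h2' := hall (θ₀ • w + y)
  simp only [map_add, LinearMap.map_smulₛₗ, map_smul, LinearMap.add_apply, LinearMap.smul_apply, smul_eq_mul, hall w,
    hall y, hθ, (hB w y).symm] at h1 h2'
  have : (2 * θ₀) * B w y = 0 := by linear_combination θ₀ * h1 - h2'
  exact (mul_eq_zero.1 this).resolve_left (mul_ne_zero h2 hθ0)

/-- **Hilbert's Theorem 90 for `K ⊇ K^σ`** in the explicit form the proof uses: an element of `σ`-norm one is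
`σν · ν⁻¹` (`ν = 1 + σμ`, or `ν = θ₀` when `μ = −1`). [folklore] -/
private theorem exists_eq_sigma_mul_inv (hσ : ∀ x : K, σ (σ x) = x) {θ₀ : K} (hθ : σ θ₀ = -θ₀) (hθ0 : θ₀ ≠ 0)
    (μ : K) (hμ : σ μ * μ = 1) : ∃ ν : K, ν ≠ 0 ∧ μ = σ ν * ν⁻¹ := by
  by_cases h1 : 1 + μ = 0
  · refine ⟨θ₀, hθ0, ?_⟩
    rw [hθ, show μ = -1 by linear_combination h1]
    field_simp
  · have hν0 : 1 + σ μ ≠ 0 := by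
      intro h0
      apply h1
      have h0' := congrArg σ h0
      rw [map_add, map_one, hσ, map_zero] at h0'
      exact h0'
    refine ⟨1 + σ μ, hν0, ?_⟩
    rw [map_add, map_one, hσ, eq_comm, mul_inv_eq_iff_eq_mul₀ hν0]
    linear_combination (-1 : K) * hμ

/-! ## §7 The theorem: `ψ` kills every isometry of determinant `1` — `SU(B)` has no non-trivial abelian quotient -/

/-- **Main theorem (abstract form).**  `K` a field with `2 ≠ 0`, `σ` an involution of `K` with `σ θ₀ = −θ₀ ≠ 0` whose
fixed field is not `𝔽₃` (`σ α = α`, `α ≠ 0`, `α² ≠ 1`), `B` a non-degenerate `σ`-hermitian form on a finite-dimensional `V`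
admitting an isotropic vector.  Then every function `ψ` on `End V` with values in a commutative group which is
multiplicative on the isometries OF DETERMINANT ONE takes the value `1` on every isometry of determinant one — i.e. every
homomorphism `SU(B) → A` to a commutative group is trivial: `SU(B)` is perfect.  Induction on `dim V` along a hyperbolic
pair `e, f`: after the reduction to `D(p)·ι(h)` (`h ∈ U({e,f}^⊥)`), the complement isotropic ⇒ split off the killed torus
element `D(p) Q(a, σp/p)` and apply the induction hypothesis to `Q(a, p/σp) h ∈ SU({e,f}^⊥)`; anisotropic ⇒ anisotropic
Cartan–Dieudonné (✔ `aniso_cartan_dieudonne`) and Hilbert 90, one quasi-symmetry at a time.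
[cite: Dieudonne1971GroupesClassiques, Chap. II §5] -/
theorem psi_eq_one_of_det_eq_one (hσ : ∀ x : K, σ (σ x) = x) {θ₀ : K} (hθ : σ θ₀ = -θ₀) (hθ0 : θ₀ ≠ 0)
    (h2 : (2 : K) ≠ 0) {α : K} (hα : σ α = α) (hα0 : α ≠ 0) (hα1 : α * α ≠ 1) {A : Type*} [CommGroup A] :
    ∀ (d : ℕ) {V : Type u} [AddCommGroup V] [Module K V] [FiniteDimensional K V],
      Module.finrank K V = d → ∀ (B : V →ₛₗ[σ] V →ₗ[K] K), (∀ x y, σ (B x y) = B y x) →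
      (∀ x, (∀ y, B x y = 0) → x = 0) → (∃ e : V, e ≠ 0 ∧ B e e = 0) →
      ∀ (ψ : Module.End K V → A),
        (∀ g h : Module.End K V, (∀ x y, B (g x) (g y) = B x y) → (∀ x y, B (h x) (h y) = B x y) →
          LinearMap.det g = 1 → LinearMap.det h = 1 → ψ (g * h) = ψ g * ψ h) →
        ∀ g : Module.End K V, (∀ x y, B (g x) (g y) = B x y) → LinearMap.det g = 1 → ψ g = 1 := by
  intro d
  induction d using Nat.strong_induction_on with
  | _ d IH =>
  intro V _ _ _ hd B hB hBnd hiso ψ hψ g hg hdet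
  classical
  obtain ⟨e, he0, he⟩ := hiso
  have h2σ : σ 2 = 2 := map_ofNat σ 2
  -- (1) a hyperbolic partner `f`
  obtain ⟨y, hy⟩ : ∃ y, B e y ≠ 0 := by
    by_contra h; push Not at h; exact he0 (hBnd e h)
  obtain ⟨y₁, hy₁⟩ : ∃ y₁ : V, y₁ = (θ₀ * (B e y)⁻¹) • y := ⟨_, rfl⟩
  have hey₁ : B e y₁ = θ₀ := by rw [hy₁, map_smul, smul_eq_mul, inv_mul_cancel_right₀ hy]
  obtain ⟨f, hfdef⟩ : ∃ f : V, f = y₁ + (B y₁ y₁ * (2 * θ₀)⁻¹) • e := ⟨_, rfl⟩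
  have hef : B e f = θ₀ := by rw [hfdef, map_add, map_smul, he, smul_zero, add_zero, hey₁]
  have hf : B f f = 0 := by
    have hy₁e : B y₁ e = -θ₀ := by rw [← hB e y₁, hey₁, hθ]
    rw [hfdef]
    simp only [map_add, LinearMap.map_smulₛₗ, map_smul, LinearMap.add_apply, LinearMap.smul_apply, smul_eq_mul, map_mul,
      map_inv₀, h2σ, hθ, hB y₁ y₁, he, hey₁, hy₁e]
    field_simp
    ring
  have hfe := apply_fe B hB hef hθ
  -- (2) the complement `W = {e, f}^⊥`, the extension `ι`, the restricted form
  set W : Submodule K V := LinearMap.ker (B e) ⊓ LinearMap.ker (B f) with hWdef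
  have hmemW : ∀ {w : V}, w ∈ W ↔ B e w = 0 ∧ B f w = 0 := fun {w} => by
    rw [hWdef, Submodule.mem_inf, LinearMap.mem_ker, LinearMap.mem_ker]
  have hc := isCompl_pair B hB he hf hef hθ hθ0
  have horth : ∀ w ∈ W, ∀ y ∈ Submodule.span K {e, f}, B w y = 0 := orth_pair B hB e f
  obtain ⟨ι, hι₁, hι₂, hιdet⟩ := exists_extension W _ hc
  have hBW : ∀ x y : W, σ (B.domRestrict₁₂ W W x y) = B.domRestrict₁₂ W W y x := fun x y => by
    simp only [LinearMap.domRestrict₁₂_apply]; exact hB _ _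
  have hBWnd : ∀ x : W, (∀ y : W, B.domRestrict₁₂ W W x y = 0) → x = 0 := by
    intro x hx
    have hx2 := hmemW.1 x.2
    refine Subtype.ext (eq_zero_of_orth B hB hBnd he hf hef hθ hθ0 (x : V) hx2.1 hx2.2 fun w hw1 hw2 => ?_)
    have := hx ⟨w, hmemW.2 ⟨hw1, hw2⟩⟩
    rwa [LinearMap.domRestrict₁₂_apply] at this
  have hιiso : ∀ h : Module.End K W, (∀ x y : W, B.domRestrict₁₂ W W (h x) (h y) = B.domRestrict₁₂ W W x y) →
      ∀ x y, B (ι h x) (ι h y) = B x y := fun h hh =>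
    extension_isometry B hB W _ hc horth ι hι₁ hι₂ h (fun x y => by simpa only [LinearMap.domRestrict₁₂_apply] using hh x y)
  -- (3) reduction: `g₂ = t' t g` with `g₂ e = p e`, `g₂ f = (σp)⁻¹ f`, `ψ g₂ = ψ g`, `det g₂ = 1`
  have hge0 : g e ≠ 0 := by
    intro h0
    have := hg e f
    rw [h0, map_zero, LinearMap.zero_apply, hef] at this
    exact hθ0 this.symm
  obtain ⟨t, ht, htψ, htdet, p, htp⟩ :=
    psi_exists_killed_apply_mem_line B ψ hψ hB hσ h2 he hf hef hθ hθ0 hα hα0 hα1 hBnd (g e) hge0 (by rw [hg, he])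
  obtain ⟨hp, t', ht', ht'ψ, ht'det, ht'e, ht'f⟩ :=
    psi_exists_killed_apply_eq_f B ψ hψ hB hσ h2 he hf hef hθ hθ0 hα hα0 hα1 (t * g) (isometry_mul B _ _ ht hg) p
      (by rw [Module.End.mul_apply, htp])
  have hσp : σ p ≠ 0 := fun h => hp (by simpa [hσ] using congrArg σ h)
  set g₂ := t' * (t * g) with hg₂def
  have hg₂ : ∀ x y, B (g₂ x) (g₂ y) = B x y := isometry_mul B _ _ ht' (isometry_mul B _ _ ht hg)
  have hg₂e : g₂ e = p • e := by rw [hg₂def, Module.End.mul_apply, Module.End.mul_apply, htp, map_smul, ht'e]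
  have hg₂f : g₂ f = (σ p)⁻¹ • f := by rw [hg₂def, Module.End.mul_apply, ht'f]
  have hdettg : LinearMap.det (t * g) = 1 := by rw [map_mul, htdet, hdet, one_mul]
  have hψg₂ : ψ g₂ = ψ g := by
    rw [hg₂def, hψ _ _ ht' (isometry_mul B _ _ ht hg) ht'det hdettg, hψ _ _ ht hg htdet hdet, ht'ψ, htψ, one_mul,
      one_mul]
  have hdetg₂ : LinearMap.det g₂ = 1 := by rw [hg₂def, map_mul, ht'det, hdettg, one_mul]
  -- (4) the Levi factor: `g₂ = D(p) ι h`
  have hDiso : ∀ α' : K, α' ≠ 0 → ∀ x y, B (((1 : Module.End K V) + ((1 - α') * θ₀⁻¹) • (B f).smulRight e +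
      (((σ α')⁻¹ - 1) * θ₀⁻¹) • (B e).smulRight f) x) (((1 : Module.End K V) + ((1 - α') * θ₀⁻¹) • (B f).smulRight e +
      (((σ α')⁻¹ - 1) * θ₀⁻¹) • (B e).smulRight f) y) = B x y := fun α' hα' => dil_isometry B hB hσ he hf hef hθ hθ0 α' hα'
  set k := ((1 : Module.End K V) + ((1 - p⁻¹) * θ₀⁻¹) • (B f).smulRight e +
      (((σ p⁻¹)⁻¹ - 1) * θ₀⁻¹) • (B e).smulRight f) * g₂ with hkdef
  have hk : ∀ x y, B (k x) (k y) = B x y := isometry_mul B _ _ (hDiso p⁻¹ (inv_ne_zero hp)) hg₂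
  have hke : k e = e := by
    rw [hkdef, Module.End.mul_apply, hg₂e, map_smul, dil_apply_e B hB he hef hθ hθ0, smul_smul, mul_inv_cancel₀ hp,
      one_smul]
  have hkf : k f = f := by
    rw [hkdef, Module.End.mul_apply, hg₂f, map_smul, dil_apply_f B hf hef hθ0, smul_smul, map_inv₀, inv_inv,
      inv_mul_cancel₀ hσp, one_smul]
  have hkW : ∀ w ∈ W, k w ∈ W := by
    intro w hw
    rw [hmemW] at hw ⊢
    constructor
    · rw [← hke, hk, hw.1]
    · rw [← hkf, hk, hw.2]
  set h : Module.End K W := k.restrict hkW with hhdef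
  have hkι : k = ι h := by
    refine eq_of_isCompl _ _ hc _ _ (fun w hw => ?_) (fun y hy => ?_)
    · rw [show w = ((⟨w, hw⟩ : W) : V) from rfl, hι₁, hhdef, LinearMap.coe_restrict_apply]
    · obtain ⟨a, b, rfl⟩ := Submodule.mem_span_pair.1 hy
      rw [hι₂ _ _ hy, map_add, map_smul, map_smul, hke, hkf]
  have hhiso : ∀ x y : W, B.domRestrict₁₂ W W (h x) (h y) = B.domRestrict₁₂ W W x y := fun x y => by
    simp only [LinearMap.domRestrict₁₂_apply, hhdef, LinearMap.coe_restrict_apply, hk]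
  have hg₂D : g₂ = ((1 : Module.End K V) + ((1 - p) * θ₀⁻¹) • (B f).smulRight e +
      (((σ p)⁻¹ - 1) * θ₀⁻¹) • (B e).smulRight f) * ι h := by
    rw [← hkι, hkdef, ← mul_assoc, dil_mul_dil B hB he hf hef hθ hθ0, mul_inv_cancel₀ hp, dil_one, one_mul]
  have hdeth : p * (σ p)⁻¹ * LinearMap.det (ι h) = 1 := by
    rw [← det_dil B hB hf hef hθ hθ0 p, ← map_mul, ← hg₂D, hdetg₂]
  have hNp : σ (p * (σ p)⁻¹) * (p * (σ p)⁻¹) = 1 := by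
    rw [map_mul, map_inv₀, hσ]; field_simp
  have hNp' : σ (σ p * p⁻¹) * (σ p * p⁻¹) = 1 := by
    rw [map_mul, map_inv₀, hσ]; field_simp
  rw [← hψg₂, hg₂D]
  -- (5) induction on the complement
  by_cases hWiso : ∃ w : W, w ≠ 0 ∧ B.domRestrict₁₂ W W w w = 0
  · -- `W` isotropic: split off `D(p) Q(a, σp/p)` and use the induction hypothesis on `Q(a, p/σp) h ∈ SU(W)`
    have hlt : Module.finrank K W < d := by
      rw [← hd]
      refine Submodule.finrank_lt fun htop => hθ0 ?_
      have : e ∈ W := by rw [htop]; exact Submodule.mem_top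
      have h' := (hmemW.1 this).2
      rw [hfe, neg_eq_zero] at h'
      exact h'
    have hψW : ∀ g' h' : Module.End K W,
        (∀ x y : W, B.domRestrict₁₂ W W (g' x) (g' y) = B.domRestrict₁₂ W W x y) →
        (∀ x y : W, B.domRestrict₁₂ W W (h' x) (h' y) = B.domRestrict₁₂ W W x y) →
        LinearMap.det g' = 1 → LinearMap.det h' = 1 →
        ψ (ι (g' * h')) = ψ (ι g') * ψ (ι h') := by
      intro g' h' hg' hh' hdg' hdh'
      rw [map_mul, hψ _ _ (hιiso g' hg') (hιiso h' hh') (by rw [hιdet]; exact hdg') (by rw [hιdet]; exact hdh')]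
    have hWne : ∃ w : W, w ≠ 0 := by obtain ⟨w, hw, -⟩ := hWiso; exact ⟨w, hw⟩
    obtain ⟨a, ha⟩ := exists_anisotropic (B.domRestrict₁₂ W W) hBW hBWnd hθ hθ0 h2 hWne
    have haV : B (a : V) (a : V) ≠ 0 := by rwa [LinearMap.domRestrict₁₂_apply] at ha
    have ha2 := hmemW.1 a.2
    -- the correcting quasi-symmetry on `W`
    set QW : Module.End K W := (1 : Module.End K W) +
      ((p * (σ p)⁻¹ - 1) * (B.domRestrict₁₂ W W a a)⁻¹) • (B.domRestrict₁₂ W W a).smulRight a with hQW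
    have hQWiso : ∀ x y : W, B.domRestrict₁₂ W W (QW x) (QW y) = B.domRestrict₁₂ W W x y :=
      quasi_isometry (B.domRestrict₁₂ W W) hBW a ha _ hNp
    have hdet1 : LinearMap.det (QW * h) = 1 := by
      rw [map_mul, hQW, det_quasi (B.domRestrict₁₂ W W) a ha, ← hιdet, hdeth]
    have hIH := IH _ hlt rfl (B.domRestrict₁₂ W W) hBW hBWnd hWiso (fun h' => ψ (ι h')) hψW (QW * h)
      (fun x y => by rw [Module.End.mul_apply, Module.End.mul_apply, hQWiso, hhiso]) hdet1
    have hιQ : ι (QW * h) = ((1 : Module.End K V) + ((p * (σ p)⁻¹ - 1) * (B (a : V) (a : V))⁻¹) •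
        (B (a : V)).smulRight (a : V)) * ι h := by
      rw [map_mul, hQW, extension_quasi B W _ hc horth ι hι₁ hι₂ a (p * (σ p)⁻¹)]
    have hQQ : ((1 : Module.End K V) + ((σ p * p⁻¹ - 1) * (B (a : V) (a : V))⁻¹) • (B (a : V)).smulRight (a : V)) *
        ((1 : Module.End K V) + ((p * (σ p)⁻¹ - 1) * (B (a : V) (a : V))⁻¹) • (B (a : V)).smulRight (a : V)) = 1 := by
      rw [quasi_mul_quasi B (a : V) haV, show σ p * p⁻¹ * (p * (σ p)⁻¹) = 1 by field_simp, quasi_one]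
    have hsplit : ((1 : Module.End K V) + ((1 - p) * θ₀⁻¹) • (B f).smulRight e +
        (((σ p)⁻¹ - 1) * θ₀⁻¹) • (B e).smulRight f) * ι h =
        (((1 : Module.End K V) + ((1 - p) * θ₀⁻¹) • (B f).smulRight e + (((σ p)⁻¹ - 1) * θ₀⁻¹) • (B e).smulRight f) *
          ((1 : Module.End K V) + ((σ p * p⁻¹ - 1) * (B (a : V) (a : V))⁻¹) • (B (a : V)).smulRight (a : V))) *
        ι (QW * h) := by
      rw [hιQ, mul_assoc, ← mul_assoc ((1 : Module.End K V) + ((σ p * p⁻¹ - 1) * (B (a : V) (a : V))⁻¹) •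
        (B (a : V)).smulRight (a : V)), hQQ, one_mul]
    have hdetDQ : LinearMap.det (((1 : Module.End K V) + ((1 - p) * θ₀⁻¹) • (B f).smulRight e +
        (((σ p)⁻¹ - 1) * θ₀⁻¹) • (B e).smulRight f) *
        ((1 : Module.End K V) + ((σ p * p⁻¹ - 1) * (B (a : V) (a : V))⁻¹) • (B (a : V)).smulRight (a : V))) = 1 := by
      rw [map_mul, det_dil B hB hf hef hθ hθ0 p, det_quasi B (a : V) haV]
      field_simp
    rw [hsplit, hψ _ _ (isometry_mul B _ _ (hDiso p hp) (quasi_isometry B hB (a : V) haV _ hNp'))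
      (hιiso _ (fun x y => by rw [Module.End.mul_apply, Module.End.mul_apply, hQWiso, hhiso])) hdetDQ
      (by rw [hιdet]; exact hdet1),
      psi_dil_mul_quasi B hB hσ he hf hef hθ hθ0 ha2.1 ha2.2 haV ψ hψ h2 hα hα0 hα1 p hp, one_mul]
    exact hIH
  · -- `W` anisotropic: anisotropic Cartan–Dieudonné on `W`, one quasi-symmetry at a time via Hilbert 90
    push Not at hWiso
    have hanW : ∀ w : W, B.domRestrict₁₂ W W w w = 0 → w = 0 := fun w hw => by
      by_contra h0; exact hWiso w h0 hw
    have hCD := aniso_cartan_dieudonne hσ h2 _ rfl (B.domRestrict₁₂ W W) hBW hanW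
      (fun h' => (∀ x y, B (ι h' x) (ι h' y) = B x y) ∧
        ∀ q : K, q ≠ 0 → q * (σ q)⁻¹ * LinearMap.det (ι h') = 1 →
          ψ (((1 : Module.End K V) + ((1 - q) * θ₀⁻¹) • (B f).smulRight e +
            (((σ q)⁻¹ - 1) * θ₀⁻¹) • (B e).smulRight f) * ι h') = 1)
      ⟨by rw [map_one]; exact isometry_one B, fun q hq0 hq => by
        rw [map_one, map_one, mul_one] at hq
        have hσq0 : σ q ≠ 0 := fun h0 => by rw [h0, inv_zero, mul_zero] at hq; exact zero_ne_one hq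
        have hσq : σ q = q := ((mul_inv_eq_one₀ hσq0).1 hq).symm
        rw [map_one, mul_one]
        exact psi_dil_of_fixed B ψ hψ hB hσ h2 he hf hef hθ hθ0 hα hα0 hα1 q hσq hq0⟩
      (by
        rintro b μ k' hb hμ ⟨hk'iso, hk'⟩
        have hbV : B (b : V) (b : V) ≠ 0 := by rwa [LinearMap.domRestrict₁₂_apply] at hb
        have hb2 := hmemW.1 b.2
        have hQb := quasi_isometry B hB (b : V) hbV μ hμ
        refine ⟨?_, fun q hq0 hq => ?_⟩
        · rw [map_mul, extension_quasi B W _ hc horth ι hι₁ hι₂ b μ]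
          exact isometry_mul B _ _ hQb hk'iso
        · rw [map_mul, extension_quasi B W _ hc horth ι hι₁ hι₂ b μ] at hq ⊢
          rw [map_mul, det_quasi B (b : V) hbV μ] at hq
          obtain ⟨ν, hν0, hμν⟩ := exists_eq_sigma_mul_inv hσ hθ hθ0 μ hμ
          subst hμν
          have hσν0 : σ ν ≠ 0 := fun h0 => hν0 (by simpa [hσ] using congrArg σ h0)
          have hσq0 : σ q ≠ 0 := fun h0 => hq0 (by simpa [hσ] using congrArg σ h0)
          have hq' : ν⁻¹ * q ≠ 0 := mul_ne_zero (inv_ne_zero hν0) hq0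
          have hD : ((1 : Module.End K V) + ((1 - q) * θ₀⁻¹) • (B f).smulRight e +
              (((σ q)⁻¹ - 1) * θ₀⁻¹) • (B e).smulRight f) =
              ((1 : Module.End K V) + ((1 - ν) * θ₀⁻¹) • (B f).smulRight e +
                (((σ ν)⁻¹ - 1) * θ₀⁻¹) • (B e).smulRight f) *
              ((1 : Module.End K V) + ((1 - ν⁻¹ * q) * θ₀⁻¹) • (B f).smulRight e +
                (((σ (ν⁻¹ * q))⁻¹ - 1) * θ₀⁻¹) • (B e).smulRight f) := by
            rw [dil_mul_dil B hB he hf hef hθ hθ0, mul_inv_cancel_left₀ hν0]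
          have hdet' : ν⁻¹ * q * (σ (ν⁻¹ * q))⁻¹ * LinearMap.det (ι k') = 1 := by
            rw [← hq, map_mul, map_inv₀]
            field_simp
          have hdet₁ : LinearMap.det (((1 : Module.End K V) + ((1 - ν) * θ₀⁻¹) • (B f).smulRight e +
              (((σ ν)⁻¹ - 1) * θ₀⁻¹) • (B e).smulRight f) *
              ((1 : Module.End K V) + ((σ ν * ν⁻¹ - 1) * (B (b : V) (b : V))⁻¹) • (B (b : V)).smulRight (b : V))) = 1 := by
            rw [map_mul, det_dil B hB hf hef hθ hθ0 ν, det_quasi B (b : V) hbV]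
            field_simp
          have hdet₂ : LinearMap.det (((1 : Module.End K V) + ((1 - ν⁻¹ * q) * θ₀⁻¹) • (B f).smulRight e +
              (((σ (ν⁻¹ * q))⁻¹ - 1) * θ₀⁻¹) • (B e).smulRight f) * ι k') = 1 := by
            rw [map_mul, det_dil B hB hf hef hθ hθ0]; exact hdet'
          rw [hD, mul_assoc, ← mul_assoc _ _ (ι k'),
            dil_mul_quasi_comm B hB e f θ₀ (ν⁻¹ * q) (b : V) hb2.1 hb2.2 (σ ν * ν⁻¹), mul_assoc, ← mul_assoc,
            hψ _ _ (isometry_mul B _ _ (hDiso ν hν0) hQb) (isometry_mul B _ _ (hDiso _ hq') hk'iso) hdet₁ hdet₂,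
            psi_dil_mul_quasi B hB hσ he hf hef hθ hθ0 hb2.1 hb2.2 hbV ψ hψ h2 hα hα0 hα1 ν hν0, one_mul]
          exact hk' _ hq' hdet')
      h hhiso
    exact hCD.2 p hp hdeth

/-- **`K^σ ≠ 𝔽₃` from `3 ≠ 0`**: then `α = 2` is `σ`-fixed, non-zero, with `α² ≠ 1` — the side hypothesis of the main
theorem in every characteristic `≠ 2, 3` (in particular for number fields and their completions); Dieudonné's exceptional
cases `𝔽₄`, `𝔽₉` are exactly the ones this side condition and `2 ≠ 0` exclude. [cite: Dieudonne1971GroupesClassiques, Chap. II §5] -/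
theorem exists_fixed_sq_ne_one_of_three_ne_zero (h2 : (2 : K) ≠ 0) (h3 : (3 : K) ≠ 0) :
    ∃ α : K, σ α = α ∧ α ≠ 0 ∧ α * α ≠ 1 :=
  ⟨2, map_ofNat σ 2, h2, fun h => h3 (by linear_combination h)⟩

/-! ## §8 Matrix form: `SU(J) = ker (det : U(J) → Kˣ)` is perfect for `unitaryGroupOfForm σ J`, any non-degenerate
hermitian `J` of any finite rank admitting an isotropic vector -/

section MatrixForm

variable {n : Type*} [Fintype n] [DecidableEq n]

/-- The sesquilinear form of `J`: `B_J x y = ᵗσ(x) J y = Σᵢⱼ σ(xᵢ) J i j yⱼ`. [folklore] -/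
private theorem toLinearMapₛₗ₂'_apply_eq (J : Matrix n n K) (x y : n → K) :
    Matrix.toLinearMapₛₗ₂' K σ (RingHom.id K) J x y = dotProduct (fun i => σ (x i)) (J.mulVec y) := by
  rw [Matrix.toLinearMapₛₗ₂'_apply]
  simp only [RingHom.id_apply, smul_eq_mul, dotProduct, Matrix.mulVec, Finset.mul_sum]
  exact Finset.sum_congr rfl fun i _ => Finset.sum_congr rfl fun j _ => by ring

/-- `B_J (M x) (M y) = ᵗσ(x) (ᵗσ(M) J M) y`. [folklore] -/
private theorem form_toLin' (J M : Matrix n n K) (x y : n → K) :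
    Matrix.toLinearMapₛₗ₂' K σ (RingHom.id K) J (Matrix.toLin' M x) (Matrix.toLin' M y) =
      dotProduct (fun i => σ (x i)) (((M.map σ).transpose * J * M).mulVec y) := by
  rw [toLinearMapₛₗ₂'_apply_eq, Matrix.toLin'_apply, Matrix.toLin'_apply]
  have h1 : (fun i => σ ((M.mulVec x) i)) = (M.map σ).mulVec (fun i => σ (x i)) := by
    funext i
    rw [RingHom.map_mulVec]
    rfl
  rw [h1, ← Matrix.vecMul_transpose, ← Matrix.dotProduct_mulVec, Matrix.mulVec_mulVec, Matrix.mulVec_mulVec]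

omit [Fintype n] in
/-- `σ` applied to a basis vector `Pi.single i 1` gives it back. [folklore] -/
private theorem sigma_single (i : n) : (fun k => σ (Pi.single (M := fun _ => K) i (1 : K) k)) = Pi.single i 1 := by
  funext k
  by_cases h : k = i
  · subst h; rw [Pi.single_eq_same, map_one]
  · rw [Pi.single_eq_of_ne h, map_zero]

/-- Membership in `SU(J) = ker (det : U(J) → Kˣ)`: `g ∈ SU(J) ↔ det g = 1` (the definition of `SU_n(K, f) = U_n⁺(K, f)`).
[cite: Dieudonne1971GroupesClassiques, Chap. II §5] -/
theorem su_mem_iff (J : Matrix n n K) (g : ↥(unitaryGroupOfForm σ J)) :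
    g ∈ (Matrix.GeneralLinearGroup.det.comp (unitaryGroupOfForm σ J).subtype).ker ↔ g.1.1.det = 1 := by
  rw [MonoidHom.mem_ker, MonoidHom.comp_apply, Subgroup.subtype_apply, ← Matrix.GeneralLinearGroup.val_det_apply,
    Units.val_eq_one]

/-- **Main theorem, matrix form: `SU(J)` is perfect.**  For a field `K` with `2 ≠ 0`, an involution `σ` with
`σ θ₀ = −θ₀ ≠ 0` whose fixed field is not `𝔽₃` (some `σ α = α ≠ 0` with `α² ≠ 1`), and a non-degenerate `σ`-hermitian
matrix `J` of ANY finite size admitting an isotropic vector (`ᵗσ(x) J x = 0`, `x ≠ 0`), every homomorphism from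
`SU(J) = ker (det : unitaryGroupOfForm σ J → Kˣ)` to a commutative group is TRIVIAL.
[cite: Dieudonne1971GroupesClassiques, Chap. II §5] -/
theorem su_apply_eq_one {A : Type*} [CommGroup A] (hσ : ∀ x : K, σ (σ x) = x) {θ₀ : K}
    (hθ : σ θ₀ = -θ₀) (hθ0 : θ₀ ≠ 0) (h2 : (2 : K) ≠ 0) (hK : ∃ α : K, σ α = α ∧ α ≠ 0 ∧ α * α ≠ 1)
    (J : Matrix n n K) (hJh : (J.map σ).transpose = J) (hJdet : J.det ≠ 0)
    (hiso : ∃ x : n → K, x ≠ 0 ∧ dotProduct (fun i => σ (x i)) (J.mulVec x) = 0)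
    (χ : ↥(Matrix.GeneralLinearGroup.det.comp (unitaryGroupOfForm σ J).subtype).ker →* A)
    (g : ↥(Matrix.GeneralLinearGroup.det.comp (unitaryGroupOfForm σ J).subtype).ker) : χ g = 1 := by
  classical
  obtain ⟨α, hα, hα0, hα1⟩ := hK
  set B := Matrix.toLinearMapₛₗ₂' K σ (RingHom.id K) J with hBdef
  have hBap : ∀ x y, B x y = dotProduct (fun i => σ (x i)) (J.mulVec y) := toLinearMapₛₗ₂'_apply_eq J
  have hJ' : ∀ i j, σ (J i j) = J j i := by
    intro i j
    have h := congrFun (congrFun hJh j) i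
    rw [Matrix.transpose_apply, Matrix.map_apply] at h
    exact h
  -- hermitian
  have hB : ∀ x y, σ (B x y) = B y x := by
    intro x y
    rw [hBap, hBap]
    simp only [dotProduct, Matrix.mulVec, map_sum, map_mul, hσ, hJ', Finset.mul_sum]
    rw [Finset.sum_comm]
    exact Finset.sum_congr rfl fun i _ => Finset.sum_congr rfl fun j _ => by ring
  -- non-degenerate
  have hBnd : ∀ x, (∀ y, B x y = 0) → x = 0 := by
    intro x hx
    have hv : Matrix.vecMul (fun i => σ (x i)) J = 0 := by
      funext j
      have := hx (Pi.single j 1)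
      rwa [hBap, Matrix.dotProduct_mulVec, dotProduct_single, mul_one] at this
    have h0 := Matrix.eq_zero_of_vecMul_eq_zero hJdet hv
    funext i
    have hi := congrFun h0 i
    simp only [Pi.zero_apply] at hi
    rw [← hσ (x i), hi, map_zero]
    rfl
  -- isotropic
  have hBiso : ∃ e : n → K, e ≠ 0 ∧ B e e = 0 := by
    obtain ⟨x, hx0, hxx⟩ := hiso
    exact ⟨x, hx0, by rw [hBap]; exact hxx⟩
  -- unitarity ↔ isometry
  have hiso_of_mem : ∀ M : Matrix n n K, (M.map σ).transpose * J * M = J →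
      ∀ x y, B (Matrix.toLin' M x) (Matrix.toLin' M y) = B x y := by
    intro M hM x y
    rw [hBdef, form_toLin', hM, ← toLinearMapₛₗ₂'_apply_eq]
  have hmem_of_iso : ∀ M : Matrix n n K, (∀ x y, B (Matrix.toLin' M x) (Matrix.toLin' M y) = B x y) →
      (M.map σ).transpose * J * M = J := by
    intro M hM
    ext i j
    have h := hM (Pi.single i 1) (Pi.single j 1)
    rw [hBdef, form_toLin', toLinearMapₛₗ₂'_apply_eq, sigma_single, single_dotProduct, single_dotProduct, one_mul,
      one_mul, Matrix.mulVec_single_one, Matrix.mulVec_single_one, Matrix.col_apply, Matrix.col_apply] at h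
    exact h
  have hdetM : ∀ M : Matrix n n K, (M.map σ).transpose * J * M = J → M.det ≠ 0 := by
    intro M hM hM0
    have h := congrArg Matrix.det hM
    rw [Matrix.det_mul, Matrix.det_mul, hM0, mul_zero] at h
    exact hJdet h.symm
  -- representatives in `SU(J)` of determinant-one isometries
  have hrep : ∀ φ : Module.End K (n → K), (∀ x y, B (φ x) (φ y) = B x y) → LinearMap.det φ = 1 →
      ∃ g' : ↥(Matrix.GeneralLinearGroup.det.comp (unitaryGroupOfForm σ J).subtype).ker, Matrix.toLin' g'.1.1.1 = φ := by
    intro φ hφ hdφ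
    have hM : ((LinearMap.toMatrix' φ).map σ).transpose * J * LinearMap.toMatrix' φ = J :=
      hmem_of_iso _ (by rw [Matrix.toLin'_toMatrix']; exact hφ)
    have hmemU : Matrix.GeneralLinearGroup.mkOfDetNeZero _ (hdetM _ hM) ∈ unitaryGroupOfForm σ J := by
      rw [mem_unitaryGroupOfForm_iff, Matrix.GeneralLinearGroup.val_mkOfDetNeZero]; exact hM
    have hdet1 : (⟨_, hmemU⟩ : ↥(unitaryGroupOfForm σ J)).1.1.det = 1 := by
      change (Matrix.GeneralLinearGroup.mkOfDetNeZero _ (hdetM _ hM) : Matrix n n K).det = 1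
      rw [Matrix.GeneralLinearGroup.val_mkOfDetNeZero, LinearMap.det_toMatrix']
      exact hdφ
    refine ⟨⟨⟨_, hmemU⟩, (su_mem_iff J _).2 hdet1⟩, ?_⟩
    change Matrix.toLin' ((Matrix.GeneralLinearGroup.mkOfDetNeZero _ (hdetM _ hM) : Matrix n n K)) = φ
    rw [Matrix.GeneralLinearGroup.val_mkOfDetNeZero, Matrix.toLin'_toMatrix']
  have huniq : ∀ g₁ g₂ : ↥(Matrix.GeneralLinearGroup.det.comp (unitaryGroupOfForm σ J).subtype).ker,
      Matrix.toLin' g₁.1.1.1 = Matrix.toLin' g₂.1.1.1 → g₁ = g₂ :=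
    fun g₁ g₂ h => Subtype.ext (Subtype.ext (Units.ext (Matrix.toLin'.injective h)))
  -- the function on `End`, multiplicative on determinant-one isometries
  let ψ : Module.End K (n → K) → A := fun φ =>
    if h : ∃ g' : ↥(Matrix.GeneralLinearGroup.det.comp (unitaryGroupOfForm σ J).subtype).ker, Matrix.toLin' g'.1.1.1 = φ then
      χ h.choose else 1
  have hψval : ∀ g' : ↥(Matrix.GeneralLinearGroup.det.comp (unitaryGroupOfForm σ J).subtype).ker,
      ψ (Matrix.toLin' g'.1.1.1) = χ g' := by
    intro g'
    have h : ∃ g'' : ↥(Matrix.GeneralLinearGroup.det.comp (unitaryGroupOfForm σ J).subtype).ker,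
        Matrix.toLin' g''.1.1.1 = Matrix.toLin' g'.1.1.1 := ⟨g', rfl⟩
    simp only [ψ, dif_pos h]
    rw [huniq _ _ h.choose_spec]
  have hψ : ∀ φ φ' : Module.End K (n → K), (∀ x y, B (φ x) (φ y) = B x y) → (∀ x y, B (φ' x) (φ' y) = B x y) →
      LinearMap.det φ = 1 → LinearMap.det φ' = 1 → ψ (φ * φ') = ψ φ * ψ φ' := by
    intro φ φ' hφ hφ' hdφ hdφ'
    obtain ⟨gφ, rfl⟩ := hrep φ hφ hdφ
    obtain ⟨gφ', rfl⟩ := hrep φ' hφ' hdφ'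
    have : Matrix.toLin' gφ.1.1.1 * Matrix.toLin' gφ'.1.1.1 = Matrix.toLin' (gφ * gφ').1.1.1 := by
      rw [Module.End.mul_eq_comp, ← Matrix.toLin'_mul]; rfl
    rw [this, hψval, hψval, hψval, map_mul]
  have hgdet : g.1.1.1.det = 1 := (su_mem_iff J g.1).1 g.2
  have key := psi_eq_one_of_det_eq_one hσ hθ hθ0 h2 hα hα0 hα1 (Module.finrank K (n → K)) rfl B hB hBnd hBiso ψ hψ
    (Matrix.toLin' g.1.1.1) (hiso_of_mem _ g.1.2) (by rw [LinearMap.det_toLin']; exact hgdet)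
  rwa [hψval] at key

/-- **`SU(J)` is a perfect group**: its commutator subgroup is all of `SU(J)` (isotropic non-degenerate hermitian `J`,
`2 ≠ 0`, `K^σ ≠ 𝔽₃`). [cite: Dieudonne1971GroupesClassiques, Chap. II §5] -/
theorem su_commutator_eq_top (hσ : ∀ x : K, σ (σ x) = x) {θ₀ : K} (hθ : σ θ₀ = -θ₀) (hθ0 : θ₀ ≠ 0)
    (h2 : (2 : K) ≠ 0) (hK : ∃ α : K, σ α = α ∧ α ≠ 0 ∧ α * α ≠ 1) (J : Matrix n n K)
    (hJh : (J.map σ).transpose = J) (hJdet : J.det ≠ 0)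
    (hiso : ∃ x : n → K, x ≠ 0 ∧ dotProduct (fun i => σ (x i)) (J.mulVec x) = 0) :
    commutator ↥(Matrix.GeneralLinearGroup.det.comp (unitaryGroupOfForm σ J).subtype).ker = ⊤ := by
  rw [eq_top_iff]
  intro g _
  have key := su_apply_eq_one hσ hθ hθ0 h2 hK J hJh hJdet hiso Abelianization.of g
  rwa [← MonoidHom.mem_ker, Abelianization.ker_of] at key

/-- **`⁅SU(J), SU(J)⁆ = SU(J)`** inside `U(J)`: every unitary matrix of determinant one is a product of commutators of
unitary matrices of determinant one. [cite: Dieudonne1971GroupesClassiques, Chap. II §5] -/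
theorem su_commutator_su_eq (hσ : ∀ x : K, σ (σ x) = x) {θ₀ : K} (hθ : σ θ₀ = -θ₀) (hθ0 : θ₀ ≠ 0)
    (h2 : (2 : K) ≠ 0) (hK : ∃ α : K, σ α = α ∧ α ≠ 0 ∧ α * α ≠ 1) (J : Matrix n n K)
    (hJh : (J.map σ).transpose = J) (hJdet : J.det ≠ 0)
    (hiso : ∃ x : n → K, x ≠ 0 ∧ dotProduct (fun i => σ (x i)) (J.mulVec x) = 0) :
    ⁅(Matrix.GeneralLinearGroup.det.comp (unitaryGroupOfForm σ J).subtype).ker,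
      (Matrix.GeneralLinearGroup.det.comp (unitaryGroupOfForm σ J).subtype).ker⁆ =
      (Matrix.GeneralLinearGroup.det.comp (unitaryGroupOfForm σ J).subtype).ker := by
  rw [← Subgroup.map_subtype_commutator, su_commutator_eq_top hσ hθ hθ0 h2 hK J hJh hJdet hiso, ← MonoidHom.range_eq_map,
    Subgroup.range_subtype]

/-- **`U(J)″ = U(J)′`**: the commutator subgroup `U(J)′ = SU(J)` (✔ `commutator_eq_ker_det`) of an isotropic unitary
group is its own commutator subgroup — the derived series of `U(J)` is stationary from the first step on.
[cite: Dieudonne1971GroupesClassiques, Chap. II §5] -/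
theorem commutator_commutator_eq (hσ : ∀ x : K, σ (σ x) = x) {θ₀ : K} (hθ : σ θ₀ = -θ₀) (hθ0 : θ₀ ≠ 0)
    (h2 : (2 : K) ≠ 0) (hK : ∃ α : K, σ α = α ∧ α ≠ 0 ∧ α * α ≠ 1) (J : Matrix n n K)
    (hJh : (J.map σ).transpose = J) (hJdet : J.det ≠ 0)
    (hiso : ∃ x : n → K, x ≠ 0 ∧ dotProduct (fun i => σ (x i)) (J.mulVec x) = 0) :
    ⁅commutator ↥(unitaryGroupOfForm σ J), commutator ↥(unitaryGroupOfForm σ J)⁆ =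
      commutator ↥(unitaryGroupOfForm σ J) := by
  rw [commutator_eq_ker_det hσ hθ hθ0 h2 J hJh hJdet hiso]
  exact su_commutator_su_eq hσ hθ hθ0 h2 hK J hJh hJdet hiso

/-- `derivedSeries` form of `U(J)″ = U(J)′`. [cite: Dieudonne1971GroupesClassiques, Chap. II §5] -/
theorem derivedSeries_two_eq_one (hσ : ∀ x : K, σ (σ x) = x) {θ₀ : K} (hθ : σ θ₀ = -θ₀) (hθ0 : θ₀ ≠ 0)
    (h2 : (2 : K) ≠ 0) (hK : ∃ α : K, σ α = α ∧ α ≠ 0 ∧ α * α ≠ 1) (J : Matrix n n K)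
    (hJh : (J.map σ).transpose = J) (hJdet : J.det ≠ 0)
    (hiso : ∃ x : n → K, x ≠ 0 ∧ dotProduct (fun i => σ (x i)) (J.mulVec x) = 0) :
    derivedSeries ↥(unitaryGroupOfForm σ J) 2 = derivedSeries ↥(unitaryGroupOfForm σ J) 1 := by
  rw [derivedSeries_succ, derivedSeries_one]
  exact commutator_commutator_eq hσ hθ hθ0 h2 hK J hJh hJdet hiso

/-- Membership form of `su_apply_eq_one`: for a homomorphism `χ` on the subgroup type `↥SU(J)` and `g ∈ U(J)` with
`det g = 1`, `χ ⟨g, _⟩ = 1`. [cite: Dieudonne1971GroupesClassiques, Chap. II §5] -/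
theorem su_apply_mk_eq_one {A : Type*} [CommGroup A] (hσ : ∀ x : K, σ (σ x) = x) {θ₀ : K}
    (hθ : σ θ₀ = -θ₀) (hθ0 : θ₀ ≠ 0) (h2 : (2 : K) ≠ 0) (hK : ∃ α : K, σ α = α ∧ α ≠ 0 ∧ α * α ≠ 1)
    (J : Matrix n n K) (hJh : (J.map σ).transpose = J) (hJdet : J.det ≠ 0)
    (hiso : ∃ x : n → K, x ≠ 0 ∧ dotProduct (fun i => σ (x i)) (J.mulVec x) = 0)
    (χ : ↥(Matrix.GeneralLinearGroup.det.comp (unitaryGroupOfForm σ J).subtype).ker →* A)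
    (g : ↥(unitaryGroupOfForm σ J)) (hg : g.1.1.det = 1) :
    χ ⟨g, (su_mem_iff J g).2 hg⟩ = 1 :=
  su_apply_eq_one hσ hθ hθ0 h2 hK J hJh hJdet hiso χ _

/-- Hypothesis form for a matrix `M` propositionally equal to `J` (the shape of the tree's local unitary groups, whose
forms are `J.map φ`). [cite: Dieudonne1971GroupesClassiques, Chap. II §5] -/
theorem su_apply_eq_one' {A : Type*} [CommGroup A] (hσ : ∀ x : K, σ (σ x) = x) {θ₀ : K}
    (hθ : σ θ₀ = -θ₀) (hθ0 : θ₀ ≠ 0) (h2 : (2 : K) ≠ 0) (hK : ∃ α : K, σ α = α ∧ α ≠ 0 ∧ α * α ≠ 1)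
    (M J : Matrix n n K) (hM : M = J) (hJh : (J.map σ).transpose = J) (hJdet : J.det ≠ 0)
    (hiso : ∃ x : n → K, x ≠ 0 ∧ dotProduct (fun i => σ (x i)) (J.mulVec x) = 0)
    (χ : ↥(Matrix.GeneralLinearGroup.det.comp (unitaryGroupOfForm σ M).subtype).ker →* A)
    (g : ↥(Matrix.GeneralLinearGroup.det.comp (unitaryGroupOfForm σ M).subtype).ker) : χ g = 1 := by
  subst hM
  exact su_apply_eq_one hσ hθ hθ0 h2 hK M hJh hJdet hiso χ g

/-- Hypothesis form of `U(J)″ = U(J)′` for `M = J`. [cite: Dieudonne1971GroupesClassiques, Chap. II §5] -/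
theorem commutator_commutator_eq' (hσ : ∀ x : K, σ (σ x) = x) {θ₀ : K} (hθ : σ θ₀ = -θ₀) (hθ0 : θ₀ ≠ 0)
    (h2 : (2 : K) ≠ 0) (hK : ∃ α : K, σ α = α ∧ α ≠ 0 ∧ α * α ≠ 1) (M J : Matrix n n K) (hM : M = J)
    (hJh : (J.map σ).transpose = J) (hJdet : J.det ≠ 0)
    (hiso : ∃ x : n → K, x ≠ 0 ∧ dotProduct (fun i => σ (x i)) (J.mulVec x) = 0) :
    ⁅commutator ↥(unitaryGroupOfForm σ M), commutator ↥(unitaryGroupOfForm σ M)⁆ =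
      commutator ↥(unitaryGroupOfForm σ M) := by
  subst hM
  exact commutator_commutator_eq hσ hθ hθ0 h2 hK M hJh hJdet hiso

end MatrixForm

end UnitaryIsotropic

end Literature.NumberTheory.Automorphic
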